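import Mathlib
import HarnessLib
import HarnessLib.Audit
import Summits.Langlands.Statement
import Literature.FieldTheory.AlgClosed.PadicAlgClEquivComplex
import Literature.NumberTheory.PAdicHodge.FontaineDpst
import Literature.NumberTheory.GaloisRepresentations.InducedGaloisRep
import Summits.Langlands.Langlands.Theorems.EisensteinDegreeShiftSectorComplementStubAvatarConjugacy
import Literature.NumberTheory.Automorphic.LocalLanglandsGLProofs
import Literature.NumberTheory.Automorphic.LocalConstantsProofs
import HarnessLib.Audit.Status.Attr

/-!
Route: MonodromyDichotomy

# Route MonodromyDichotomy — reciprocity for GL(n) from the Fontaine–Mazur–Langlands core split by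
connected-monodromy type (Lie-irreducible, Artin type, structured transport)

Decomposition node of the Langlands root ladder (cell decomp-langlands, lens-2 «structural
dichotomy: special vs generic», gen 2), refining
N0 = route-Langlands-PrimeSwitchSplit rev 4 at its core B_w =
`PrimeSwitchSplit.WeakGeometricAutomorphy` (stmt-Langlands-17414: every irreducible
pinned-geometric ℓ-adic ρ : Γ_K → GL_n(ℚ̄_ℓ) is weakly automorphic). Split B_w by the TYPE OF THE
IDENTITY COMPONENT OF THE ALGEBRAIC MONODROMY
GROUP of ρ, typed through finite extensions only: GENERIC = Lie-irreducible (irreducible on every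
finite-index subgroup) → G; SPECIAL-RIGID =
finite projective image (Artin type) → S1; SPECIAL-STRUCTURED = the rest, which by the Clifford–Tate
structure theorem T (print) is induced from a
proper finite extension or an Artin–Kronecker product ρ₁ ⊗ ρ₂, and is transported from lower rank by
S2 (open functoriality fed by strong induction
on n; rank 1 = R1, print). It suffices to show X = R1 ∧ G ∧ S1 ∧ T ∧ S2 ∧ (N0's W⁺, P, L∤R, CRD
verbatim); kernel-certified B_w ⟺ R1 ∧ G ∧ S1 ∧ S2
modulo T (`weakGeometricAutomorphy_iff`) and B_w ⟺ R1 ∧ G ∧ S1 ∧ S2' outright; every piece is WEAKER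
than B_w. No idea card is realised.
WHY THIS IS NOVEL: the first posted PARTITION of B_w whose cells are closed under the whole print
transfer groupoid (algebraic twists, restriction to EVERY finite L, descent; automorphic induction
only raises the rank into S2, which carries the lower-rank hypothesis explicitly) — the
connected-monodromy TYPE of ρ (Lie-irreducible / finite projective image / Clifford–Tate structured)
is used by no other node of the cell and by no item of the Langlands Theses (critic NOVELTY ✓;
nearest: PrimitiveRankLadder's K-rational self-twist primitivity 24803/24804 — different predicates,
cited as RELATED, not parents). LINEAGE: NODE decomp-langlands-lens-2-g2 2026-08-30T02:31:18Z
(HOME/STATUS.md L77), CLEARED by decomp-langlands crit-1 CLEARED 2026-08-30T02:36:18Z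
(HOME/STATUS.md L80; HOME/CRITIC-LEDGER.md row 19) (TYPING ✓ no junk; GUARDS target ROOT ✓,
NECESSARY/WEAKER ✓, EXACT ✓ 0 EQUIV, DISTRIBUTED ✓ three OPEN cells G / S1 / S2 + print R1, T;
ORBIT-CLOSURE ✓; NOVELTY ✓; leaf tags accepted), filing kit NOTE lens-2-g2 02:38:56Z (L83: Route.md
schema OK, route.json, glue.lean natively certified: rendered Theses rc0 · 0 sorry · closes axioms
std · 9/9 binders used); filed by the cell's route-writer decomp-langlands-writer-1 (gen 2) as
ROOT-level sibling #6 of RootDecomp1 / ResidualSplit / WeightMultiplicitySplit / PrimitiveRankLadder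
/ DepthPrimeSplit / AnchoredFamilySplit (alternative decompositions of B_w = separate routes sharing
N0's items by dedup, D-0019). Census instrument of record: HOME/census/COSTUME-CENSUS-v2.md sha256
92d1557a2c5727820a56011751c388b645a7fc2e57306ba099f059e21d7ae085 — its HC1 first open box (K = ℚ, n
= 2, even icosahedral Artin ρ) lies in S1 = ArtinTypeAutomorphy ONLY (critic: the first filed axis
that cuts INSIDE the common residual); G's real first box is even distinct-weight beyond Calegari /
mixed-signature K; S2's is A₅-quintic induction / ⊗ beyond (2,3). Rung currency: rung 0.
Lean: `RankOneAutomorphy ∧ LieIrreducibleAutomorphy ∧ ArtinTypeAutomorphy ∧ CliffordTateStructure ∧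
StructuredTransport ∧ SatakeAvatarExistence ∧ PadicMemberCompatibility ∧ CompatibilityAwayFromLR ∧
CanonicalReciprocityData`

## Assembly
Level 2 (the node's seam, proved inside `closes`, no extra item): weak geometric automorphy at every
rank n by strong induction — n = 1 from
RankOneAutomorphy; n ≥ 2: if ρ is Lie-irreducible, LieIrreducibleAutomorphy; else if ρ has finite
projective image, ArtinTypeAutomorphy; else
CliffordTateStructure exhibits ρ as induced / Artin–Kronecker from irreducible pinned-geometric
pieces of rank < n and StructuredTransport closes
it from the induction hypothesis. This yields B_w verbatim. Level 1 is N0's certified glue verbatim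
(prime switch ℓ' ∈ {2, 3} for the places over
ℓ, P for de Rhamness and the member switch, L∤R away from ℓ, CRD for `Nonempty (ReciprocityData F)`,
U = the landed theorem
`Theorems.EisensteinDegreeShiftSectorComplement.stub_avatarConjugacy` for uniqueness in (A), W⁺ for
existence in (A)).

Rationale: WHY THIS LINE. The mechanism is the structure theory of irreducible representations by their
connected monodromy (Clifford 1937; Katz1990ESDE Prop. 2.7.2;
Patrikis arXiv:1207.6724 Prop. 4.1.1 «lietensorart» with the ℓ-adic Tate lift Prop. «tatelift», from
Tate's H²(Γ_K, ℚ/ℤ) = 0): an irreducible ρ is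
Lie-irreducible, or induced from a proper open subgroup, or a tensor product of a Lie-irreducible
representation with an irreducible Artin
representation of dimension ≥ 2 (Artin type being the degenerate case d = n). Each cell has its own
engine: G = automorphy lifting / potential
automorphy (BLGGT2014, ACCGHLNSTT2023, arXiv:1307.1640, Kisin2009FontaineMazur) and contains
conjecturally NO equal-weight representation
(Fontaine–Mazur finite-image conjecture; Calegari arXiv:0907.3427); S1 = converse theorems,
weight-one congruences and solvable base change
(KhareWintenberger2009, Langlands1980BaseChange, Tunnell1981, ArthurClozel1989); S2 = functoriality
by the trace formula and Rankin–Selberg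
(ArthurClozel1989 III.6, Harris1998, JPSS1981GL3, Ramakrishnan2000, KimShahidi2002). Imported area:
algebraic groups / Tannakian monodromy
(Katz) into the automorphy problem. What it does that prior routes do not: PrimitiveRankLadder
(lens-1) grades by rank modulo K-rational self-twist
with a PRINTED cyclic transport, so its open grades still contain every Artin-type ρ, every ρ
induced from a non-normal extension and every
Artin–Kronecker product; Weight/Depth/FLShape/Residual cuts use Hodge–Tate data, primes or residual
images and each of their cells meets all
three monodromy types. Here G omits all special ρ, S1 isolates strong Artin, S2 is open
functoriality anchored by the induction hypothesis
(no leak: Ind/⊗ built from ρ needs ρ in lower rank), and T is a landable intermediate theorem.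
Negatives index (`ledger negatives --problem
Langlands`: 17212, 16822, 16951, 3797) contains no monodromy, Artin or induction statement.

RANKED CRUXES. #2 LieIrreducibleAutomorphy (crux) — (G, generic cell) for every number field K, n ≥
2, prime ℓ, ι : ℚ̄_ℓ ≃ ℂ and every irreducible pinned-geometric ρ : Γ_K → GL_n(ℚ̄_ℓ) (a.e.
unramified, de Rham at v ∣ ℓ in the tree's pinned sense) that stays irreducible on Γ_L for EVERY
number field L ⊇ K, there is an L-algebraic cuspidal π of GL_n(𝔸_K) whose Satake parameters match
ρ(Frob_v) at almost all v. Omits every Artin-type, induced and Artin–Kronecker ρ; closed under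
algebraic twists, all finite restrictions and descent. TAGS (decomp-langlands crit-1 CLEARED
2026-08-30T02:36:18Z (HOME/STATUS.md L80; HOME/CRITIC-LEDGER.md row 19); census
HOME/census/COSTUME-CENSUS-v2.md sha256
92d1557a2c5727820a56011751c388b645a7fc2e57306ba099f059e21d7ae085): WEAKER (kernel
`pieces_of_weakGeometricAutomorphy` + exactness `weakGeometricAutomorphy_iff` / `_iff_exact`,
nodes/lens-2-g2-MonodromyDichotomy.lean; probes piece ⇏ Langlands ×4, piece ⇏ B_w ×3, drop-one ×4,
vacuity ×14 all as expected, nodes/lens-2-g2-MonodromyDichotomy.probes.lean) · OPEN · the BULK of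
B_w (all «genuinely motivic» ρ: patching world) · INSTRUMENTABLE sectors (BLGGT Thm 4.2.1 regular
polarizable p.d.; Kisin–KW–Pan GL₂/ℚ odd; FLHS; ACC+ Thm 6.1.1; Newton–Thorne symmetric powers;
instrument: Patrikis trace-zero density reads the cell off Satake data in a compatible system) ·
leaf IDEA-NEEDED on its residual (even ρ, Hodge–Tate-irregular ρ, mixed-signature K) · BARRIER
`Literature.Barriers.Langlands.TaylorWilesNumericalCoincidence_holds`,
`TwistedEndoscopySelfDual_holds`, `NonRegularWeightBarrier_holds`,
`ShimuraVarietyRealizationBarrier_holds` bound its engines (not evaded on the residual, honestly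
said) — OUTSIDE `SolvableImageBarrier_holds` (no Artin-type ρ in the cell). [difficulty:
open-problem] (why it might fail: an EVEN, Hodge–Tate-irregular or mixed-signature Lie-irreducible ρ
(e.g. rank 2 over ℚ, even, infinite image) has no known automorphic construction (no Shimura
variety, l₀ > 0 for patching); a single non-automorphic such ρ refutes it — and refutes B_w.)
[arXiv:1207.6724, arXiv:1307.1640, arXiv:0907.3427, BLGGT2014, ACCGHLNSTT2023,
Kisin2009FontaineMazur]
#3 ArtinTypeAutomorphy (crux) — (S1, special-rigid cell) the same conclusion for every irreducible
pinned-geometric ρ of rank n ≥ 2 whose restriction to SOME number field L ⊇ K is scalar (finite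
projective image; ρ = σ ⊗ χ with σ of finite image and χ a geometric character): the strong Artin
conjecture up to twist, in weak (a.e. Satake) form. Disjoint from G in rank ≥ 2 (kernel lemma
`not_isLieIrreducible_of_hasFiniteProjectiveImage`). Contains the census's first open box (ℚ, n = 2,
even icosahedral). TAGS (decomp-langlands crit-1 CLEARED 2026-08-30T02:36:18Z (HOME/STATUS.md L80;
HOME/CRITIC-LEDGER.md row 19); census HOME/census/COSTUME-CENSUS-v2.md sha256
92d1557a2c5727820a56011751c388b645a7fc2e57306ba099f059e21d7ae085): WEAKER (kernel
`pieces_of_weakGeometricAutomorphy` + exactness `weakGeometricAutomorphy_iff` / `_iff_exact`,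
nodes/lens-2-g2-MonodromyDichotomy.lean; probes piece ⇏ Langlands ×4, piece ⇏ B_w ×3, drop-one ×4,
vacuity ×14 all as expected, nodes/lens-2-g2-MonodromyDichotomy.probes.lean) · OPEN · the cell
holding the census's first open box at EVERY prime and the ONLY cell that does (critic CENSUS ANSWER
accepted) · INSTRUMENTABLE / ATTACKABLE sectors closed-mod-print: K = ℚ, n = 2, odd
(`Literature.NumberTheory.Automorphic.khare_wintenberger` + Kisin), soluble image n = 2
(Langlands–Tunnell, `StrongArtinGL2Proofs.langlands_tunnell_of_three_cases`), nilpotent image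
(Arthur–Clozel), n = 1 · leaf IDEA-NEEDED on its residual (even icosahedral / ℚ = target 2903's box;
primitive non-solvable rank ≥ 3) · BARRIER
`Literature.Barriers.Langlands.SolvableImageBarrier_holds` (the Langlands–Tunnell / solvable
base-change engine — not evaded), `NonRegularWeightBarrier_holds` (weight-one / Maass-type π),
`ShimuraVarietyRealizationBarrier_holds`. [difficulty: open-problem] (why it might fail: even
icosahedral Artin representations of Γ_ℚ and primitive non-solvable Artin representations of rank ≥
3 (PSL₂(7) ⊂ GL₃, A₆, …) have no known automorphic realisation (no odd weight-one congruence trick,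
no Shimura variety, descent only along solvable towers); a non-automorphic one refutes it.)
[KhareWintenberger2009, Kisin2009FontaineMazur, Langlands1980BaseChange, Tunnell1981,
ArthurClozel1989, arXiv:0907.3427]
#4 StructuredTransport (crux) — (S2, special-structured cell = functorial transport) for every
irreducible pinned-geometric ρ of rank n ≥ 2 that is INDUCED (its characteristic polynomials agree
with those of `FramedGaloisRep.induce` of an irreducible pinned-geometric σ : Γ_L → GL_m(ℚ̄_ℓ),
[L:K] ≥ 2, n = [L:K]·m) or ARTIN–KRONECKER (charpoly ρ(g) = charpoly (ρ₁(g) ⊗ ρ₂(g)) with ρ₁, ρ₂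
irreducible pinned-geometric of dimensions a, d ≥ 2, n = a·d, ρ₂ of finite image): if weak geometric
automorphy holds at every rank m < n over every number field, then ρ is weakly automorphic —
automorphic induction along an arbitrary finite extension and GL_a × GL_d → GL_ad, cuspidality from
irreducibility. TAGS (decomp-langlands crit-1 CLEARED 2026-08-30T02:36:18Z (HOME/STATUS.md L80;
HOME/CRITIC-LEDGER.md row 19); census HOME/census/COSTUME-CENSUS-v2.md sha256
92d1557a2c5727820a56011751c388b645a7fc2e57306ba099f059e21d7ae085): WEAKER (kernel
`pieces_of_weakGeometricAutomorphy` + exactness `weakGeometricAutomorphy_iff` / `_iff_exact`,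
nodes/lens-2-g2-MonodromyDichotomy.lean; probes piece ⇏ Langlands ×4, piece ⇏ B_w ×3, drop-one ×4,
vacuity ×14 all as expected, nodes/lens-2-g2-MonodromyDichotomy.probes.lean) — S2 sees only induced
/ Artin–Kronecker shapes and is handed B_w strictly below rank n (strong induction inside
`weakAutomorphyAtRank_all`) · OPEN = functoriality world (automorphic induction along NON-solvable
finite extensions; GL_a × GL_d → GL_ad beyond (2,2), (2,3)) · ATTACKABLE sectors closed-mod-print:
solvable/cyclic induction (ArthurClozel1989, tree AI facts; = PrimitiveRankLadder's
CyclicInductionTransport 24806 on cyclic layers), Kim–Shahidi (2,2)/(2,3) · leaf IDEA-NEEDED beyond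
(A₅-quintic induction; ⊗ beyond (2,3)) · BARRIER
`Literature.Barriers.Langlands.SolvableImageBarrier_holds` (non-solvable layer, not evaded) /
`TwistedEndoscopySelfDual_holds` (functorial transfers proved by self-dual twisted endoscopy only).
[deps: CliffordTateStructure] [difficulty: open-problem] (why it might fail: automorphic induction
from an extension with non-solvable Galois closure (e.g. an A₅-quintic) and GL_a × GL_d tensor
functoriality for a·d ≥ 8 are open cases of Langlands functoriality with neither a solvable tower
nor a twisted-endoscopic realisation; a non-automorphic Ind or ⊗ refutes it.) [ArthurClozel1989,
Harris1998, JPSS1981GL3, Ramakrishnan2000, KimShahidi2002, arXiv:1207.6724]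
#5 SatakeAvatarExistence (crux) — W⁺ of N0 verbatim (stmt-Langlands-17415; ledger dedup): every
L-algebraic cuspidal π of GL_n(𝔸_K) has, for every ℓ and ι, an irreducible ℓ-adic avatar matching
its Satake parameters almost everywhere. TAGS (shared N0 item stmt-Langlands-17415 by dedup; critic
rows 1/19; census v2): WEAKER · OPEN · inherited unchanged from PrimeSwitchSplit / RootDecomp1
(construction side; BARRIER ShimuraVarietyRealizationBarrier_holds / NonRegularWeightBarrier_holds /
TwistedEndoscopySelfDual_holds). [difficulty: open-problem] (why it might fail: Galois
representations for non-cohomological π (Maass forms of eigenvalue 1/4, mixed-signature fields) and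
irreducibility of r_π for n ≥ 3 are open.) [HarrisLanTaylorThorneRMS2016, Scholze2015,
BuzzardGeeLMS2014]
#6 PadicMemberCompatibility (crux) — P of N0 verbatim (stmt-Langlands-17534; ledger dedup): ℓ = p
local–global compatibility of avatars (de Rham at v ∣ ℓ with the predicted Weil–Deligne type) and
the member switch between the ℓ- and ℓ'-adic avatars of one π. TAGS (shared N0 item
stmt-Langlands-17534 by dedup; critic rows 1/19): WEAKER · OPEN · inherited unchanged (carved on
RootDecomp1 rev 2/3 by lens-6: DR ∧ S_p ∧ GEN_p ∧ RECGEN ∧ WDU; BARRIER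
MonodromyNotClosedUnderPadicLimits). [difficulty: open-problem] (why it might fail: ℓ = p
local–global compatibility (de Rham + WD matching at v ∣ ℓ) for non-cohomological or non-polarizable
π is open beyond the Shimura-variety cases.) [Caraiani2014, BLGGT2014, arXiv:2207.05235]
#7 CompatibilityAwayFromLR (crux) — L∤R of N0 verbatim (stmt-Langlands-18084; ledger dedup): full
local–global compatibility of an avatar at the places v ∤ ℓ outside the prescribed finite set. TAGS
(shared N0 item stmt-Langlands-18084 by dedup; critic rows 1/19): WEAKER · OPEN · inherited
unchanged (split on RootDecomp1: G ∧ R ∧ S ∧ N; BARRIER MonodromyNotClosedUnderPadicLimits).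
[difficulty: open-problem] (why it might fail: full local–global compatibility (monodromy operator
N) at v ∤ ℓ is open in the non-polarizable / torsion settings (Varma gives it up to
semisimplification).) [Varma2014, TaylorYoshida2007, Caraiani2012]
#9 CliffordTateStructure (support) — (T, PRINT: Patrikis arXiv:1207.6724 Prop. 4.1.1 + Tate lift;
Katz ESDE Prop. 2.7.2; Clifford) an irreducible pinned-geometric ℓ-adic ρ of rank n ≥ 2 that is
neither Lie-irreducible nor of finite projective image is induced from an irreducible
pinned-geometric representation of a proper finite extension, or is an Artin–Kronecker product with
both factors irreducible pinned-geometric of dimension ≥ 2 and the second of finite image — in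
characteristic-polynomial form (geometricity of the factors: σ ⊂ ρ|Γ_L; ρ₁ ⊂ ρ ⊗ ρ₂^∨). TAGS
(decomp-langlands crit-1 CLEARED 2026-08-30T02:36:18Z (HOME/STATUS.md L80; HOME/CRITIC-LEDGER.md row
19); census HOME/census/COSTUME-CENSUS-v2.md sha256
92d1557a2c5727820a56011751c388b645a7fc2e57306ba099f059e21d7ae085): PRINT support (Clifford theory +
ℓ-adic Tate lift: Patrikis arXiv:1207.6724 Prop. 4.1.1; Katz ESDE Prop. 2.7.2) — the critic verified
the trichotomy is TRUE in print as typed (Γ⁰ := ρ⁻¹(G⁰): non-isotypic ⇒ induced from the stabiliser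
with an irreducible pinned-geometric summand; isotypic ⇒ τ ⊗ ω with τ Lie-irreducible after the Tate
lift and ω of finite projective image; d = 1 contradicts ¬G, a = 1 contradicts ¬S1; τ de Rham as a
sub of ρ ⊗ ω^∨) · WEAKER (B_w ⇏ T is a probe: T is structure, not automorphy; exact complement S2'
certifies B_w ⟺ R1 ∧ G ∧ S1 ∧ S2' outright) · leaf ATTACKABLE now (landable Theorems file) · no
catalogued barrier. [difficulty: M] (why it might fail: only through typing: if the pinned
IsDeRhamFramed / a.e.-unramified predicates lacked heredity under finite restriction, sub-objects
and ⊗ by a finite-image rep (those Literature facts land first); FramedGaloisRep.induce models Ind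
up to conjugacy (charpoly_induce_eq_charpoly_comp_indMatrix).) [arXiv:1207.6724, Katz1990ESDE,
SerreLinearRepresentations1977, Clifford1937, arXiv:1307.1640]
#9 RankOneAutomorphy (support) — (R1 = stmt-Langlands-24805 `PrimitiveRankLadder.RankOneAutomorphy`
VERBATIM; ledger dedup) every irreducible pinned-geometric ℓ-adic character of Γ_K is weakly
automorphic (class field theory + Weil's algebraic Hecke characters + Serre III.2.3); the base of
the strong induction on the rank. TAGS (shared by dedup = stmt-Langlands-24805
`PrimitiveRankLadder.RankOneAutomorphy`, critic rows 4/15/19): PRINT support · WEAKER · ATTACKABLE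
(CFT + Weil + Serre III.2.3) — the base of the strong induction on the rank. [difficulty: M] (why it
might fail: print; fails only if the pinned de Rham predicate at ℓ did not imply local algebraicity
of the Hecke character (it does: de Rham characters are Hodge–Tate, Serre III.A.5).)
[Serre1968AbelianEllAdic, Weil1956Hecke]
#9 CanonicalReciprocityData (support) — CRD of N0 verbatim (stmt-Langlands-17930; ledger dedup):
every number field carries a `ReciprocityData` (closed-mod-print: LLC for GL_n + Fontaine's D_pst).
TAGS (shared N0 item stmt-Langlands-17930 by dedup): PRINT support (LLC for GL_n
HarrisTaylor2001/Henniart/Scholze + Fontaine D_pst) · ATTACKABLE. [difficulty: M] (why it might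
fail: print (LLC for GL_n); fails only if the tree's ReciprocityData structure demands a field
beyond LLC + its standard properties.) [HarrisTaylor2001, Henniart2000, Scholze2013LLC]

TWO-LAYER PLAN. Foreseen (not filed now; it would make 7 open binders): `StructuredTransport ⇐
InductionTransport → KroneckerTransport → StructuredTransport`
(glue = the case split on the disjunction) — InductionTransport = non-normal / non-solvable
automorphic induction GL_m/L ⇒ GL_{[L:K]m}/K for
cuspidal L-algebraic π with irreducible induced Galois parameter; KroneckerTransport = GL_a × GL_d →
GL_{ad} for an (L-algebraic cuspidal) × (Artin
cuspidal) pair with irreducible product. For G, once a sector closes: `LieIrreducibleAutomorphy ⇐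
RegularPolarizable → NonPolarizableOrIrregular`
along BLGGT's hypotheses (the first child is INSTRUMENTABLE by BLGGT2014 Thm 4.2.1 / ACCGHLNSTT2023
Thm 6.1.1).

KILL CRITERIA. A non-automorphic Lie-irreducible geometric ρ refutes LieIrreducibleAutomorphy AND
B_w AND Langlands (close --reason refuted:LieIrreducibleAutomorphy,
and N0 dies with it); likewise a non-automorphic Artin representation (refuted:ArtinTypeAutomorphy)
or a non-automorphic induction / Artin–Kronecker
product of automorphic pieces (refuted:StructuredTransport) — each is a counterexample to Langlands
itself, so no pivot exists. A refutation of
CliffordTateStructure can only be a TYPING defect of the pinned predicates (IsDeRhamFramed heredity,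
`FramedGaloisRep.induce`): pivot = restate T
with the corrected heredity hypothesis as a new support item and re-certify `closes`. Proved
elsewhere that moots it: B_w (stmt-Langlands-17414)
closing on any sibling route closes G, S1, S2 at once (kernel `pieces_of_weakGeometricAutomorphy`).

NOT DECOMPOSED YET. The induced / Kronecker halves of StructuredTransport (layer 2 above); the
regular-polarizable vs residual sectors of G (BLGGT hypotheses: ℓ > 2(n+1),
residual adequacy, potential diagonalizability) — deliberately NOT cut at open because every
hypothesis-list cut of G is a «known ∧ rest» costume
(critic rule 01:15:58Z) unless the complement is typed by an intrinsic invariant; the n = 2 / K = ℚ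
odd case of S1 (Khare–Wintenberger) as a BC5 rung.

CHEAPEST FALSIFIER. Lookup, ran it: is there an irreducible geometric ρ that is neither
Lie-irreducible, nor of finite projective image, nor induced, nor Artin–Kronecker
with BOTH factors geometric? Patrikis Prop. 4.1.1 + Prop. «tatelift» [corpus:arxiv-1207.6724 p.60,
p.14–15] say no over number fields (the Tate lift
makes the projective factorisation linear with geometric factors after a geometric twist absorbed
into ρ₁); Katz ESDE Prop. 2.7.2
[corpus:katz1990-exponential-sums-differential-equations p.51] is the algebraic-group statement. The
in-Lean degenerate-witness probes (26, all
`sorry`-isolated, rc 0) found no piece provable from vacuity, no piece implying Langlands or B_w by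
the standard battery, and no droppable binder.

NUMBERS. n ≥ 2 threshold only (rank 1 = R1, print). BLGGT potential automorphy needs ℓ > 2(n + 1)
and regular weights (BLGGT2014 Thm 4.2.1); Ramakrishnan /
Kim–Shahidi give GL_a × GL_d → GL_ad exactly for (a, d) = (2, 2), (2, 3); automorphic induction is
known for [L:K] with SOLVABLE Galois closure
(ArthurClozel1989 III.6.2, Harris1998).

DEFINITION REQUESTS. None: Lie-irreducibility, finite projective image, induced-from-lower-rank and
Artin–Kronecker are inlined over `FramedGaloisRep.restrictField`,
`FramedGaloisRep.induce`, `FramedRep.charpoly` and `Matrix.kroneckerMap` (all in tree / Mathlib).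

Novelty: Searches RAN (2026-08-30): `lit search --hybrid` («Lie irreducible Galois representation automorphy»
→ [corpus:arxiv-1207.6724 p.60–63]; «Clifford theory induced tensor decomposition irreducible
representation normal subgroup» → [corpus:katz1990-exponential-sums-differential-equations p.50–54];
«strong Artin conjecture even icosahedral» → [corpus:arxiv-0907.3427]); `lit galaxy search
"Lie-irreducible|Lie irreducible" --star all` (hits: Patrikis «Variations on a theorem of Tate»,
Katz ESDE; no automorphy-by-monodromy-type decomposition); `lean search
'IsLieIrreducible|restrictField|induce'` (tree: `FramedGaloisRep.restrictField`,
`FramedGaloisRep.induce`, `charpoly_induce_eq_charpoly_comp_indMatrix`, `CliffordTwistDichotomy`,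
`CliffordInducedPrimeIndex`; no Lie-irreducibility predicate); `ledger negatives --problem
Langlands` (4 entries, none related); every decomp-langlands node (lens-1…6 g0/g1, census-1 g2).
Nearest prior art found: in tree — route-Langlands-PrimitiveRankLadder (lens-1: rank ladder modulo
K-rational self-twist, printed cyclic transport `automorphicInduction_cyclic_cuspidal`),
route-Langlands-WeightMultiplicitySplit (lens-2 g0: Hodge–Tate multiplicity pattern); in print —
Patrikis arXiv:1207.6724 §4.1 (the structure theorem, used there for lifting problems, not for
automorphy), Katz1990ESDE §2.7, Calegari arXiv:0907.3427 (even Fontaine–Mazur), ArthurClozel1989 /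
Harris1998 (solvable induction), Ramakrishnan2000 / KimShahidi2002 (tensor functoriality).
Delta:  [refs: 1207.6724, 0907.3427, arxiv-1207.6724, arxiv-0907.3427, ArthurClozel1989, Ramakrishnan2000, KimShahidi2002]

Barriers (technique_class: monodromy-dichotomy, automorphy-lifting, artin, transport): - technique_class: monodromy-dichotomy, automorphy-lifting, artin, transport
- Literature.Barriers.Langlands.TaylorWilesNumericalCoincidence: bites LieIrreducibleAutomorphy
exactly where l₀ > 0 (K not totally real/CM, or ρ non-polarizable) — not evaded; the bet is
derived/completed-homology patching (CalegariGeraghty2018, ACCGHLNSTT2023) inside G, and the node's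
point is that S1 and S2 are OUTSIDE the patching class altogether (converse theorems / trace
formula).
- Literature.Barriers.Langlands.NonRegularWeightBarrier: bites G at Hodge–Tate-irregular
Lie-irreducible ρ and S1 throughout (Artin type = all weights equal) — S1 does not evade it by
patching; its engines (weight-one congruences KhareWintenberger2009, Langlands–Tunnell, converse
theorems) are the only places non-cohomological automorphy has been produced, which is why S1 is a
separate item.
- Literature.Barriers.Langlands.SolvableImageBarrier: bounds the Langlands–Tunnell / Arthur–Clozel
engines of S1 (insoluble projective image) and S2 (induction along a non-solvable closure) head-on —
not evaded; the bet for S2 is functoriality beyond endoscopy / Rankin–Selberg converse theorems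
(JPSS1981GL3, Ramakrishnan2000, KimShahidi2002), for S1 prime-switch congruences à la
Khare–Wintenberger; G is OUTSIDE the class (no solvability used or usable).
- Literature.Barriers.Langlands.TwistedEndoscopySelfDual: bites G for non-polarizable ρ and S2's
Kronecker half beyond (2,2),(2,3) — not evaded; stated in the why-might-fail lines

History (route lifecycle, newest last):
- 2026-08-30T08:40:12Z · rev 2: restated LieIrreducibleAutomorphy_of_split (stmt-Langlands-26926 proved) — render-order workaround step 1 of 2 (gate8/priority14 08:24Z; precedent ResidualAvatarLadder rev 3→4): the PROVED gen-1 glue 26926 A2 → SYM → H → G is restated (planner-decomp-langlands-writer-1-g3-0)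

sub-problem: Langlands · status: draft · opened planner-decomp-langlands-writer-1-g2-0 2026-08-30T02:44:36Z · rev 3 · ledger route-Langlands-MonodromyDichotomy
GENERATED by the gate from the ledger (D-0016/17). Provers cite these decls: `theorem foo : Summit.Langlands.Langlands.Theses.MonodromyDichotomy.<Decl> := …` in Summits/Langlands/Langlands/Theorems/<Name>.lean.
-/

namespace Summit.Langlands.Langlands.Theses.MonodromyDichotomy

open scoped BigOperators Topology Manifold Classical MeasureTheory ProbabilityTheory Matrix InnerProductSpace ComplexConjugate ContinuousMap
open Filter Set Function TopologicalSpace MeasureTheory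

attribute [summit_statement] _root_.Langlands

/-- item stmt-Langlands-25617 · crux · rank 2 · SPLIT (gen 2) into SpecialCellAutomorphy, GenericModuliAutomorphy, SymmetricPowerTransport, HigherLieRankAutomorphy + glue LieIrreducibleAutomorphy_of_resplit · direct attempts still welcome (low priority) · by planner
why it might fail: an EVEN, Hodge–Tate-irregular or mixed-signature Lie-irreducible ρ (e.g. rank 2 over ℚ, even, infinite image) has no known automorphic construction (no Shimura variety, l₀ > 0 for patching); a single non-automorphic such ρ refutes it — and refutes B_w.
sources: arXiv:1207.6724, arXiv:1307.1640, arXiv:0907.3427, BLGGT2014, ACCGHLNSTT2023, Kisin2009FontaineMazur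
earlier split gen 1: RankTwoLieIrreducibleAutomorphy, SymmetricPowerTransport, HigherLieRankAutomorphy — retired stmt-Langlands-26923, stmt-Langlands-26924, stmt-Langlands-26925, stmt-Langlands-31202
retired/moot children: RankTwoLieIrreducibleAutomorphy [retired: ∀ (K : Type) [Field K] [NumberField K] (hcpt : Literature.NumberTheory.Automorph]; SymmetricPowerTransport [retired: ∀ (K : Type) [Field K] [NumberField K] (n : ℕ) (hcpt : Literature.NumberTheory.A]; HigherLieRankAutomorphy [retired: ∀ (K : Type) [Field K] [NumberField K] (n : ℕ) (hcpt : Literature.NumberTheory.A]; LieIrreducibleAutomorphy_of_split [replaced: RankTwoLieIrreducibleAutomorphy → SymmetricPowerTransport → HigherLieRankAutomor]; LieIrreducibleAutomorphy_of_split [retired: (∀ (K : Type) [Field K] [NumberField K] (hcpt : Literature.NumberTheory.Automorp]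
[crux] (G, generic cell) for every number field K, n ≥ 2, prime ℓ, ι : ℚ̄_ℓ ≃ ℂ and every
irreducible pinned-geometric ρ : Γ_K → GL_n(ℚ̄_ℓ) (a.e. unramified, de Rham at v ∣ ℓ in the tree's
pinned sense) that stays irreducible on Γ_L for EVERY number field L ⊇ K, there is an L-algebraic
cuspidal π of GL_n(𝔸_K) whose Satake parameters match ρ(Frob_v) at almost all v. Omits every
Artin-type, induced and Artin–Kronecker ρ; closed under algebraic twists, all finite restrictions
and descent. TAGS (decomp-langlands crit-1 CLEARED 2026-08-30T02:36:18Z (HOME/STATUS.md L80;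
HOME/CRITIC-LEDGER.md row 19); census HOME/census/COSTUME-CENSUS-v2.md sha256
92d1557a2c5727820a56011751c388b645a7fc2e57306ba099f059e21d7ae085): WEAKER (kernel
`pieces_of_weakGeometricAutomorphy` + exactness `weakGeometricAutomorphy_iff` / `_iff_exact`,
nodes/lens-2-g2-MonodromyDichotomy.lean; probes piece ⇏ Langlands ×4, piece ⇏ B_w ×3, drop-one ×4,
vacuity ×14 all as expected, nodes/lens-2-g2-MonodromyDichotomy.probes.lean) · OPEN · the BULK of
B_w (all «genuinely motivic» ρ: patching world) · INSTRUMENTABLE sectors (BLGGT Thm 4.2.1 regular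
polarizable p.d.; Kisin–KW–Pan GL₂/ℚ odd; FLHS; ACC+ Thm 6.1.1; Newton–Thorne sy -/
@[route_item "route-Langlands-MonodromyDichotomy", crux]
def LieIrreducibleAutomorphy : Prop :=
  ∀ (K : Type) [Field K] [NumberField K] (n : ℕ) (hcpt : Literature.NumberTheory.Automorphic.isCompact_glFiniteIntegralLevel n K), 2 ≤ n → ∀ (ℓ : ℕ) [Fact ℓ.Prime] (ι : PadicAlgCl ℓ ≃+* ℂ) (ρ : Literature.NumberTheory.GaloisRepresentations.FramedGaloisRep K (PadicAlgCl ℓ) n), ρ.toGaloisRep.IsIrreducible → ((∀ᶠ v : IsDedekindDomain.HeightOneSpectrum (NumberField.RingOfIntegers K) in Filter.cofinite, ρ.IsUnramifiedAt v) ∧ ∀ (v : IsDedekindDomain.HeightOneSpectrum (NumberField.RingOfIntegers K)) (hv : ((ℓ : ℕ) : NumberField.RingOfIntegers K) ∈ v.asIdeal), (Literature.NumberTheory.PAdicHodge.fontainePstAdicCompletion v ℓ hv).IsDeRhamFramed (ρ.toLocal v)) → (∀ (L : Type) [Field L] [NumberField L] [Algebra K L], (ρ.restrictField L).toGaloisRep.IsIrreducible)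 → ∃ π : Literature.NumberTheory.Automorphic.CuspidalAutomorphicRepData n K hcpt, π.1.IsLAlgebraic ∧ ∀ᶠ v : IsDedekindDomain.HeightOneSpectrum (NumberField.RingOfIntegers K) in Filter.cofinite, SatakeFrobCompatibleAt ι π.1 ρ v

-- parent: LieIrreducibleAutomorphy · child (gen 2)
/--     item stmt-Langlands-31219 · crux · rank 201 · open
    parent: LieIrreducibleAutomorphy · by planner
    why it might fail: an even Lie-irreducible 2-dimensional geometric ρ over ℚ with distinct Hodge–Tate weights and no automorphic realisation, or a non-modular elliptic curve over an imaginary quadratic field K with X₀(15)(K) infinite, refutes it (with A2, G, B_w); standalone it also needs Galois avatars for GL₂ …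
    sources: Kisin2009FontaineMazur, arXiv:0907.3427, arXiv:1901.07166, arXiv:1310.7088, arXiv:2301.10509, arXiv:1812.09999
[crux] SPECIAL CELL (lens-2-g4 ModuliFieldDichotomy; child of LieIrreducibleAutomorphy
stmt-Langlands-25617 by --resplit, superseding RankTwoLieIrreducibleAutomorphy 26923 EXACTLY: A2 ⟺
SpecialCell ∧ GenericModuliAutomorphy by excluded middle on the inlined dial, kernel
rankTwo_iff_cells): every irreducible pinned-geometric Lie-irreducible ρ : Γ_K → GL₂(ℚ̄_ℓ) that is
SOLVABLY OF TR/CM TYPE — ∃ K₀ totally real or CM, ∃ number field M ⊇ K, K₀ with M/K and M/K₀ of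
solvable Galois closure, ∃ ρ₀ : Γ_{K₀} → GL₂(ℚ̄_ℓ) irreducible pinned-geometric Lie-irreducible with
charpoly ρ(g) = scaleRoots(charpoly ρ₀(g), c_g), c_g ≠ 0 on Γ_M (⟺ ρ|Γ_M ≅ ρ₀|Γ_M ⊗ χ) — is weakly
automorphic over K. = the SATURATION of «GL₂ Fontaine–Mazur–Langlands over TR/CM fields» under the
print transfer groupoid (⊗χ, solvable restriction/descent, duals, prime switch; census G2/G7) —
ORBIT-CLOSED BY CONSTRUCTION (the first base-field axis of the cell: it cuts THROUGH every non-TR/CM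
field, putting ρ_E|Γ_K (E/ℚ, K of solvable closure) on the special side and the genuine AT3
representations on the generic side). STRUCTURE (kernel special_of_core): SpecialCell ⟸ W⁺ 17415 ∧
TRCM (A2 over TR/CM K: all print engines — Kisi -/
@[route_item "route-Langlands-MonodromyDichotomy"]
def SpecialCellAutomorphy : Prop :=
  ∀ (K : Type) [Field K] [NumberField K] (hcpt : Literature.NumberTheory.Automorphic.isCompact_glFiniteIntegralLevel 2 K) (ℓ : ℕ) [Fact ℓ.Prime] (ι : PadicAlgCl ℓ ≃+* ℂ) (ρ : Literature.NumberTheory.GaloisRepresentations.FramedGaloisRep K (PadicAlgCl ℓ) 2), ρ.toGaloisRep.IsIrreducible → ((∀ᶠ v : IsDedekindDomain.HeightOneSpectrum (NumberField.RingOfIntegers K) in Filter.cofinite, ρ.IsUnramifiedAt v) ∧ ∀ (v : IsDedekindDomain.HeightOneSpectrum (NumberField.RingOfIntegers K)) (hv : ((ℓ : ℕ) : NumberField.RingOfIntegers K) ∈ v.asIdeal), (Literature.NumberTheory.PAdicHodge.fontainePstAdicCompletion v ℓ hv).IsDeRhamFramed (ρ.toLocal v)) → (∀ (L : Type) [Field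 L] [NumberField L] [Algebra K L], (ρ.restrictField L).toGaloisRep.IsIrreducible) → (∃ (K₀ : Type) (_ : Field K₀) (_ : NumberField K₀) (M : Type) (_ : Field M) (_ : NumberField M) (_ : Algebra K M) (_ : Algebra K₀ M), (NumberField.IsTotallyReal K₀ ∨ NumberField.IsCMField K₀) ∧ (∃ (N : Type) (_ : Field N) (_ : NumberField N) (_ : Algebra K N) (_ : Algebra M N) (_ : IsScalarTower K M N), IsGalois K N ∧ IsSolvable (N ≃ₐ[K] N)) ∧ (∃ (N : Type) (_ : Field N) (_ : NumberField N) (_ : Algebra K₀ N) (_ : Algebra M N) (_ : IsScalarTower K₀ M N), IsGalois K₀ N ∧ IsSolvable (N ≃ₐ[K₀] N)) ∧ ∃ ρ₀ : Literature.NumberTheory.GaloisRepresentations.FramedGaloisRep K₀ (PadicAlgCl ℓ) 2, ρ₀.toGaloisRep.IsIrreducible ∧ ((∀ᶠ v : IsDedekindDomain.HeightOneSpectrum (NumberField.RingOfIntegers K₀) in Filter.cofinite, ρ₀.IsUnramifiedAt v) ∧ ∀ (v : IsDedekindDomain.HeightOneSpectrum (NumberField.RingOfIntegers K₀)) (hv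 : ((ℓ : ℕ) : NumberField.RingOfIntegers K₀) ∈ v.asIdeal), (Literature.NumberTheory.PAdicHodge.fontainePstAdicCompletion v ℓ hv).IsDeRhamFramed (ρ₀.toLocal v)) ∧ (∀ (L : Type) [Field L] [NumberField L] [Algebra K₀ L], (ρ₀.restrictField L).toGaloisRep.IsIrreducible) ∧ ∀ g : Field.absoluteGaloisGroup M, ∃ c : PadicAlgCl ℓ, c ≠ 0 ∧ Literature.NumberTheory.GaloisRepresentations.FramedRep.charpoly (ρ.restrictField M) g = (Literature.NumberTheory.GaloisRepresentations.FramedRep.charpoly (ρ₀.restrictField M) g).scaleRoots c) → ∃ π : Literature.NumberTheory.Automorphic.CuspidalAutomorphicRepData 2 K hcpt, π.1.IsLAlgebraic ∧ ∀ᶠ v : IsDedekindDomain.HeightOneSpectrum (NumberField.RingOfIntegers K) in Filter.cofinite, SatakeFrobCompatibleAt ι π.1 ρ v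

-- parent: LieIrreducibleAutomorphy · child (gen 2)
/--     item stmt-Langlands-31220 · crux · rank 202 · open
    parent: LieIrreducibleAutomorphy · by planner
    why it might fail: a non-automorphic Lie-irreducible geometric ρ : Γ_K → GL₂(ℚ̄_ℓ) over a cubic field with one complex place refutes it together with A2, G, B_w and reciprocity over K; no modularity-lifting or potential-automorphy method presently reaches fields that are neither totally real nor CM (l₀ > 0, no …
    sources: arXiv:2109.14145, arXiv:1812.09999, arXiv:1207.6724, Taylor2002PotentialModularity, doi:10.1007/978-3-031-41153-3, arXiv:math/0304431
[crux] GENERIC CELL = the intrinsic AT3 core (lens-2-g4 ModuliFieldDichotomy; child of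
LieIrreducibleAutomorphy stmt-Langlands-25617 by --resplit; DECLARED RESIDUAL): every irreducible
pinned-geometric Lie-irreducible ρ : Γ_K → GL₂(ℚ̄_ℓ) that is NOT solvably of TR/CM type (no
totally-real-or-CM K₀, number field M ⊇ K, K₀ with M/K, M/K₀ of solvable Galois closure and
irreducible pinned-geometric Lie-irreducible ρ₀ over K₀ with ρ|Γ_M a pointwise twist-match of
ρ₀|Γ_M) is weakly automorphic over K. Content: K has a complex place and is not CM (over TR/CM K the
hypotheses are CONTRADICTORY — kernel genericCell_vacuous_on_TRCM) and the field of moduli of Proj ρ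
is itself not TR/CM, or ρ reaches TR/CM data only through a NON-solvable extension. FIRST OPEN BOX
(census F44 (iii) / atom AT3): (cubic K of signature (1,1), n = 2, ρ_{E′,ℓ} for E′/K with j(E′)
generic); then (S₅-quintic K with complex places, ρ_{E,ℓ}|Γ_K for E/ℚ: non-solvable base change).
SATURATED complement: closed under ⊗χ, solvable restriction/descent, duals, prime switch — no print
move carries TR/CM content into it. BARRIER head-on: ShimuraVarietyRealizationBarrier_holds (Galois
representations for GL₂ over K exist in pr -/
@[route_item "route-Langlands-MonodromyDichotomy"]
def GenericModuliAutomorphy : Prop :=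
  ∀ (K : Type) [Field K] [NumberField K] (hcpt : Literature.NumberTheory.Automorphic.isCompact_glFiniteIntegralLevel 2 K) (ℓ : ℕ) [Fact ℓ.Prime] (ι : PadicAlgCl ℓ ≃+* ℂ) (ρ : Literature.NumberTheory.GaloisRepresentations.FramedGaloisRep K (PadicAlgCl ℓ) 2), ρ.toGaloisRep.IsIrreducible → ((∀ᶠ v : IsDedekindDomain.HeightOneSpectrum (NumberField.RingOfIntegers K) in Filter.cofinite, ρ.IsUnramifiedAt v) ∧ ∀ (v : IsDedekindDomain.HeightOneSpectrum (NumberField.RingOfIntegers K)) (hv : ((ℓ : ℕ) : NumberField.RingOfIntegers K) ∈ v.asIdeal), (Literature.NumberTheory.PAdicHodge.fontainePstAdicCompletion v ℓ hv).IsDeRhamFramed (ρ.toLocal v)) → (∀ (L : Type) [Field L] [NumberField L] [Algebra K L], (ρ.restrictField L).toGaloisRep.IsIrreducible) → ¬ (∃ (K₀ : Type) (_ : Field K₀) (_ : NumberField K₀) (M : Type) (_ : Field M) (_ : NumberField M) (_ : Algebra K M) (_ : Algebra K₀ M), (NumberField.IsTotallyReal K₀ ∨ NumberField.IsCMField K₀)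 ∧ (∃ (N : Type) (_ : Field N) (_ : NumberField N) (_ : Algebra K N) (_ : Algebra M N) (_ : IsScalarTower K M N), IsGalois K N ∧ IsSolvable (N ≃ₐ[K] N)) ∧ (∃ (N : Type) (_ : Field N) (_ : NumberField N) (_ : Algebra K₀ N) (_ : Algebra M N) (_ : IsScalarTower K₀ M N), IsGalois K₀ N ∧ IsSolvable (N ≃ₐ[K₀] N)) ∧ ∃ ρ₀ : Literature.NumberTheory.GaloisRepresentations.FramedGaloisRep K₀ (PadicAlgCl ℓ) 2, ρ₀.toGaloisRep.IsIrreducible ∧ ((∀ᶠ v : IsDedekindDomain.HeightOneSpectrum (NumberField.RingOfIntegers K₀) in Filter.cofinite, ρ₀.IsUnramifiedAt v) ∧ ∀ (v : IsDedekindDomain.HeightOneSpectrum (NumberField.RingOfIntegers K₀)) (hv : ((ℓ : ℕ) : NumberField.RingOfIntegers K₀) ∈ v.asIdeal), (Literature.NumberTheory.PAdicHodge.fontainePstAdicCompletion v ℓ hv).IsDeRhamFramed (ρ₀.toLocal v)) ∧ (∀ (L : Type) [Field L] [NumberField L] [Algebra K₀ L], (ρ₀.restrictField L).toGaloisRep.IsIrreducible)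 ∧ ∀ g : Field.absoluteGaloisGroup M, ∃ c : PadicAlgCl ℓ, c ≠ 0 ∧ Literature.NumberTheory.GaloisRepresentations.FramedRep.charpoly (ρ.restrictField M) g = (Literature.NumberTheory.GaloisRepresentations.FramedRep.charpoly (ρ₀.restrictField M) g).scaleRoots c) → ∃ π : Literature.NumberTheory.Automorphic.CuspidalAutomorphicRepData 2 K hcpt, π.1.IsLAlgebraic ∧ ∀ᶠ v : IsDedekindDomain.HeightOneSpectrum (NumberField.RingOfIntegers K) in Filter.cofinite, SatakeFrobCompatibleAt ι π.1 ρ v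

-- parent: LieIrreducibleAutomorphy · child (gen 2)
/--     item stmt-Langlands-31221 · crux · rank 203 · open
    parent: LieIrreducibleAutomorphy · by planner
    why it might fail: Sym⁵ of a non-CM elliptic curve over an imaginary quadratic field that is not automorphic on GL₆ refutes it even given all of GL₂: symmetric-power functoriality beyond the Langlands–Shahidi range (m ≥ 5) is known only over totally real fields (Newton–Thorne via eigenvarieties of definite unitary …
    sources: GelbartJacquet1978, KimShahidi2002, Kim2003JAMS, arXiv:1912.11261, arXiv:2009.07180, arXiv:1207.6724
[crux] SYMMETRIC-POWER TRANSPORT (SYM; child of LieIrreducibleAutomorphy stmt-Langlands-25617; the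
SPECIAL = Lie-rank-one cell as a RANK-IH TRANSPORT, crit-1 F1 shape = census v4 rule G7): for every
K and n ≥ 3, IF LieIrreducibleAutomorphy holds at every rank 2 ≤ m < n over every number field
(inlined; at n = 3 exactly RankTwoLieIrreducibleAutomorphy) THEN every irreducible pinned-geometric
Lie-irreducible ρ : Γ_K → GL_n(ℚ̄_ℓ), n ≥ 3, WITH PROGRESSION SPECTRA near 1 (∃ open U ∋ 1, ∀ g ∈ U,
charpoly ρ(g) = ∏_{j<n}(X − c r^j); for Lie-irreducible ρ ⟺ (G°)^der = Sym^{n−1} SL₂ ⟺ ρ ≅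
Sym^{n−1}σ ⊗ χ with σ of rank 2 — Zariski-closed progression locus + weights of a maximal torus in
arithmetic progression; twist- and restriction-invariant, kernel-certified) is weakly automorphic.
Content = Sym^{n−1} functoriality GL₂ → GL_n over every number field + Tate–Patrikis lifting
bookkeeping [arXiv:1207.6724 tatelift, p.34]. Closed mod the hypothesis + print for n = 3, 4, 5 over
every K (Gelbart–Jacquet 1978, Kim–Shahidi 2002, Kim 2003 [Getz–Hahn Thm 13.6.1]) and for all n over
ℚ / totally real K for modular σ (Newton–Thorne); ceiling: Sym^{≥5} over general K («k ≥ 5 remains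
unproven»). First open -/
@[route_item "route-Langlands-MonodromyDichotomy", crux]
def SymmetricPowerTransport : Prop :=
  ∀ (K : Type) [Field K] [NumberField K] (n : ℕ) (hcpt : Literature.NumberTheory.Automorphic.isCompact_glFiniteIntegralLevel n K), 3 ≤ n → (∀ (m : ℕ), 2 ≤ m → m < n → ∀ (E : Type) [Field E] [NumberField E] (hE : Literature.NumberTheory.Automorphic.isCompact_glFiniteIntegralLevel m E) (ℓ' : ℕ) [Fact ℓ'.Prime] (ι' : PadicAlgCl ℓ' ≃+* ℂ) (σ : Literature.NumberTheory.GaloisRepresentations.FramedGaloisRep E (PadicAlgCl ℓ') m), σ.toGaloisRep.IsIrreducible → ((∀ᶠ v : IsDedekindDomain.HeightOneSpectrum (NumberField.RingOfIntegers E) in Filter.cofinite, σ.IsUnramifiedAt v) ∧ ∀ (v : IsDedekindDomain.HeightOneSpectrum (NumberField.RingOfIntegers E)) (hv : ((ℓ' : ℕ) : NumberField.RingOfIntegers E) ∈ v.asIdeal), (Literature.NumberTheory.PAdicHodge.fontainePstAdicCompletion v ℓ' hv).IsDeRhamFramed (σ.toLocal v)) → (∀ (L : Type) [Field L] [NumberField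 L] [Algebra E L], (σ.restrictField L).toGaloisRep.IsIrreducible) → ∃ π : Literature.NumberTheory.Automorphic.CuspidalAutomorphicRepData m E hE, π.1.IsLAlgebraic ∧ ∀ᶠ v : IsDedekindDomain.HeightOneSpectrum (NumberField.RingOfIntegers E) in Filter.cofinite, SatakeFrobCompatibleAt ι' π.1 σ v) → ∀ (ℓ : ℕ) [Fact ℓ.Prime] (ι : PadicAlgCl ℓ ≃+* ℂ) (ρ : Literature.NumberTheory.GaloisRepresentations.FramedGaloisRep K (PadicAlgCl ℓ) n), ρ.toGaloisRep.IsIrreducible → ((∀ᶠ v : IsDedekindDomain.HeightOneSpectrum (NumberField.RingOfIntegers K) in Filter.cofinite, ρ.IsUnramifiedAt v) ∧ ∀ (v : IsDedekindDomain.HeightOneSpectrum (NumberField.RingOfIntegers K)) (hv : ((ℓ : ℕ) : NumberField.RingOfIntegers K) ∈ v.asIdeal), (Literature.NumberTheory.PAdicHodge.fontainePstAdicCompletion v ℓ hv).IsDeRhamFramed (ρ.toLocal v)) → (∀ (L : Type) [Field L] [NumberField L] [Algebra K L], (ρ.restrictField L).toGaloisRep.IsIrreducible) → (∃ U : Set (Field.absoluteGaloisGroup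 K), IsOpen U ∧ (1 : Field.absoluteGaloisGroup K) ∈ U ∧ ∀ g ∈ U, ∃ c r : PadicAlgCl ℓ, Literature.NumberTheory.GaloisRepresentations.FramedRep.charpoly ρ g = ∏ j ∈ Finset.range n, (Polynomial.X - Polynomial.C (c * r ^ j))) → ∃ π : Literature.NumberTheory.Automorphic.CuspidalAutomorphicRepData n K hcpt, π.1.IsLAlgebraic ∧ ∀ᶠ v : IsDedekindDomain.HeightOneSpectrum (NumberField.RingOfIntegers K) in Filter.cofinite, SatakeFrobCompatibleAt ι π.1 ρ v

-- parent: LieIrreducibleAutomorphy · child (gen 2)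
/--     item stmt-Langlands-31222 · crux · rank 204 · open
    parent: LieIrreducibleAutomorphy · by planner
    why it might fail: a regular non-self-dual 3-dimensional geometric ρ over ℚ with monodromy SL₃ (van Geemen–Top type) matching no cuspidal GL₃ class refutes it even given all of GL₂: for non-polarizable ρ only lifting theorems over CM fields (ACC+) and potential automorphy exist, nothing over ℚ itself beyond …
    sources: arXiv:1010.2561, arXiv:1812.09999, arXiv:2104.09761, Ramakrishnan2000, KimShahidi2002, doi:10.1007/bf01232250
[crux] HIGHER-LIE-RANK AUTOMORPHY (H; child of LieIrreducibleAutomorphy stmt-Langlands-25617; the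
GENERIC cell as a RANK-IH TRANSPORT, census v4 rules G7/G8): for every K and n ≥ 3, IF
LieIrreducibleAutomorphy holds at every rank 2 ≤ m < n over every number field (inlined; the
Lie-irreducible factors of every Kronecker / ∧² / Asai shadow are thereby received) THEN every
irreducible pinned-geometric Lie-irreducible ρ : Γ_K → GL_n(ℚ̄_ℓ), n ≥ 3, WITHOUT progression
spectra near 1 (⟺ (G°)^der of rank ≥ 2: SL_m (m ≥ 3), Sp, SO, products A₁ × A₁ ⊂ GL₄ such as ρ_E ⊗
ρ_E′, exceptional types — the genuinely higher-rank motives) is weakly automorphic. THE BULK OF G IN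
RANK ≥ 3. Print sectors: regular polarizable potentially-diagonalizable over CM/TR — potential
automorphy (BLGGT 4.2.1) and automorphy lifting; regular non-polarizable over CM — ACC+ 6.1.1
(lifting), Qian (potential); GL₂ × GL₂ → GL₄ (Ramakrishnan 2000), GL₂ × GL₃ (Kim–Shahidi) for
product types with automorphic factors. First open box: (ℚ, 3, regular NON-self-dual ρ with
SL₃-monodromy — van Geemen–Top's σ′₁ class, census v3 F44 (iii): automorphy open). Typed conditional
on all lower Lie-irreducible ranks so that no GL₂ or lowe -/
@[route_item "route-Langlands-MonodromyDichotomy"]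
def HigherLieRankAutomorphy : Prop :=
  ∀ (K : Type) [Field K] [NumberField K] (n : ℕ) (hcpt : Literature.NumberTheory.Automorphic.isCompact_glFiniteIntegralLevel n K), 3 ≤ n → (∀ (m : ℕ), 2 ≤ m → m < n → ∀ (E : Type) [Field E] [NumberField E] (hE : Literature.NumberTheory.Automorphic.isCompact_glFiniteIntegralLevel m E) (ℓ' : ℕ) [Fact ℓ'.Prime] (ι' : PadicAlgCl ℓ' ≃+* ℂ) (σ : Literature.NumberTheory.GaloisRepresentations.FramedGaloisRep E (PadicAlgCl ℓ') m), σ.toGaloisRep.IsIrreducible → ((∀ᶠ v : IsDedekindDomain.HeightOneSpectrum (NumberField.RingOfIntegers E) in Filter.cofinite, σ.IsUnramifiedAt v) ∧ ∀ (v : IsDedekindDomain.HeightOneSpectrum (NumberField.RingOfIntegers E)) (hv : ((ℓ' : ℕ) : NumberField.RingOfIntegers E) ∈ v.asIdeal), (Literature.NumberTheory.PAdicHodge.fontainePstAdicCompletion v ℓ' hv).IsDeRhamFramed (σ.toLocal v)) → (∀ (L : Type) [Field L] [NumberField L] [Algebra E L], (σ.restrictField L).toGaloisRep.IsIrreducible)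 → ∃ π : Literature.NumberTheory.Automorphic.CuspidalAutomorphicRepData m E hE, π.1.IsLAlgebraic ∧ ∀ᶠ v : IsDedekindDomain.HeightOneSpectrum (NumberField.RingOfIntegers E) in Filter.cofinite, SatakeFrobCompatibleAt ι' π.1 σ v) → ∀ (ℓ : ℕ) [Fact ℓ.Prime] (ι : PadicAlgCl ℓ ≃+* ℂ) (ρ : Literature.NumberTheory.GaloisRepresentations.FramedGaloisRep K (PadicAlgCl ℓ) n), ρ.toGaloisRep.IsIrreducible → ((∀ᶠ v : IsDedekindDomain.HeightOneSpectrum (NumberField.RingOfIntegers K) in Filter.cofinite, ρ.IsUnramifiedAt v) ∧ ∀ (v : IsDedekindDomain.HeightOneSpectrum (NumberField.RingOfIntegers K)) (hv : ((ℓ : ℕ) : NumberField.RingOfIntegers K) ∈ v.asIdeal), (Literature.NumberTheory.PAdicHodge.fontainePstAdicCompletion v ℓ hv).IsDeRhamFramed (ρ.toLocal v)) → (∀ (L : Type) [Field L] [NumberField L] [Algebra K L], (ρ.restrictField L).toGaloisRep.IsIrreducible) → ¬ (∃ U : Set (Field.absoluteGaloisGroup K), IsOpen U ∧ (1 : Field.absoluteGaloisGroup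 K) ∈ U ∧ ∀ g ∈ U, ∃ c r : PadicAlgCl ℓ, Literature.NumberTheory.GaloisRepresentations.FramedRep.charpoly ρ g = ∏ j ∈ Finset.range n, (Polynomial.X - Polynomial.C (c * r ^ j))) → ∃ π : Literature.NumberTheory.Automorphic.CuspidalAutomorphicRepData n K hcpt, π.1.IsLAlgebraic ∧ ∀ᶠ v : IsDedekindDomain.HeightOneSpectrum (NumberField.RingOfIntegers K) in Filter.cofinite, SatakeFrobCompatibleAt ι π.1 ρ v

-- parent: LieIrreducibleAutomorphy · glue (gen 2)
/--     item stmt-Langlands-31223 · support · rank 205 · closed · proved by Summit.Langlands.Langlands.Theorems.LieIrreducibleAutomorphy_of_resplit_proof (prover)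
    parent: LieIrreducibleAutomorphy · GLUE: children ⟹ parent · by planner
SpecialCellAutomorphy → GenericModuliAutomorphy → SymmetricPowerTransport → HigherLieRankAutomorphy
→ LieIrreducibleAutomorphy — pure logic: strong induction on the rank; at n = 2 excluded middle on
the inlined solvable-TR/CM-type dial picks the special or the generic cell; at n ≥ 3 the (retired,
formerly landed) gen-1 glue 26926 argument verbatim; proof file
nodes/lens-2-g4-ModuliFieldDichotomy.split_glue.lean (theorem
LieIrreducibleAutomorphy_of_resplit_proof, binder order hSP hGE hSYM hH) ready to land as
Theorems/MonodromyDichotomyLieIrreducibleAutomorphyOfResplit.lean -/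
@[route_item "route-Langlands-MonodromyDichotomy"]
def LieIrreducibleAutomorphy_of_resplit : Prop :=
  SpecialCellAutomorphy → GenericModuliAutomorphy → SymmetricPowerTransport → HigherLieRankAutomorphy → LieIrreducibleAutomorphy

-- `LieIrreducibleAutomorphy_of_resplit` holds: proved by `Summit.Langlands.Langlands.Theorems.LieIrreducibleAutomorphy_of_resplit_proof` (its module imports this route file, so no `_holds` link can be stated here).

/-- item stmt-Langlands-25618 · crux · rank 3 · open · by planner
why it might fail: even icosahedral Artin representations of Γ_ℚ and primitive non-solvable Artin representations of rank ≥ 3 (PSL₂(7) ⊂ GL₃, A₆, …) have no known automorphic realisation (no odd weight-one congruence trick, no Shimura variety, descent only along solvable towers); a non-automorphic one refutes it.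
sources: KhareWintenberger2009, Kisin2009FontaineMazur, Langlands1980BaseChange, Tunnell1981, ArthurClozel1989, arXiv:0907.3427
[crux] (S1, special-rigid cell) the same conclusion for every irreducible pinned-geometric ρ of rank
n ≥ 2 whose restriction to SOME number field L ⊇ K is scalar (finite projective image; ρ = σ ⊗ χ
with σ of finite image and χ a geometric character): the strong Artin conjecture up to twist, in
weak (a.e. Satake) form. Disjoint from G in rank ≥ 2 (kernel lemma
`not_isLieIrreducible_of_hasFiniteProjectiveImage`). Contains the census's first open box (ℚ, n = 2,
even icosahedral). TAGS (decomp-langlands crit-1 CLEARED 2026-08-30T02:36:18Z (HOME/STATUS.md L80;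
HOME/CRITIC-LEDGER.md row 19); census HOME/census/COSTUME-CENSUS-v2.md sha256
92d1557a2c5727820a56011751c388b645a7fc2e57306ba099f059e21d7ae085): WEAKER (kernel
`pieces_of_weakGeometricAutomorphy` + exactness `weakGeometricAutomorphy_iff` / `_iff_exact`,
nodes/lens-2-g2-MonodromyDichotomy.lean; probes piece ⇏ Langlands ×4, piece ⇏ B_w ×3, drop-one ×4,
vacuity ×14 all as expected, nodes/lens-2-g2-MonodromyDichotomy.probes.lean) · OPEN · the cell
holding the census's first open box at EVERY prime and the ONLY cell that does (critic CENSUS ANSWER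
accepted) · INSTRUMENTABLE / ATTACKABLE sectors closed-mod-print: K = ℚ, n = 2, odd (`Lit -/
@[route_item "route-Langlands-MonodromyDichotomy", crux]
def ArtinTypeAutomorphy : Prop :=
  ∀ (K : Type) [Field K] [NumberField K] (n : ℕ) (hcpt : Literature.NumberTheory.Automorphic.isCompact_glFiniteIntegralLevel n K), 2 ≤ n → ∀ (ℓ : ℕ) [Fact ℓ.Prime] (ι : PadicAlgCl ℓ ≃+* ℂ) (ρ : Literature.NumberTheory.GaloisRepresentations.FramedGaloisRep K (PadicAlgCl ℓ) n), ρ.toGaloisRep.IsIrreducible → ((∀ᶠ v : IsDedekindDomain.HeightOneSpectrum (NumberField.RingOfIntegers K) in Filter.cofinite, ρ.IsUnramifiedAt v) ∧ ∀ (v : IsDedekindDomain.HeightOneSpectrum (NumberField.RingOfIntegers K)) (hv : ((ℓ : ℕ) : NumberField.RingOfIntegers K) ∈ v.asIdeal), (Literature.NumberTheory.PAdicHodge.fontainePstAdicCompletion v ℓ hv).IsDeRhamFramed (ρ.toLocal v)) → (∃ (L : Type) (_ : Field L) (_ : NumberField L) (_ : Algebra K L), ∀ σ : Field.absoluteGaloisGroup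 L, ∃ c : PadicAlgCl ℓ, ((ρ.restrictField L σ : GL (Fin n) (PadicAlgCl ℓ)) : Matrix (Fin n) (Fin n) (PadicAlgCl ℓ)) = c • (1 : Matrix (Fin n) (Fin n) (PadicAlgCl ℓ))) → ∃ π : Literature.NumberTheory.Automorphic.CuspidalAutomorphicRepData n K hcpt, π.1.IsLAlgebraic ∧ ∀ᶠ v : IsDedekindDomain.HeightOneSpectrum (NumberField.RingOfIntegers K) in Filter.cofinite, SatakeFrobCompatibleAt ι π.1 ρ v

/-- item stmt-Langlands-25619 · crux · rank 4 · open · by planner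
why it might fail: automorphic induction from an extension with non-solvable Galois closure (e.g. an A₅-quintic) and GL_a × GL_d tensor functoriality for a·d ≥ 8 are open cases of Langlands functoriality with neither a solvable tower nor a twisted-endoscopic realisation; a non-automorphic Ind or ⊗ refutes it.
sources: ArthurClozel1989, Harris1998, JPSS1981GL3, Ramakrishnan2000, KimShahidi2002, arXiv:1207.6724
[crux] (S2, special-structured cell = functorial transport) for every irreducible pinned-geometric ρ
of rank n ≥ 2 that is INDUCED (its characteristic polynomials agree with those of
`FramedGaloisRep.induce` of an irreducible pinned-geometric σ : Γ_L → GL_m(ℚ̄_ℓ), [L:K] ≥ 2, n =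
[L:K]·m) or ARTIN–KRONECKER (charpoly ρ(g) = charpoly (ρ₁(g) ⊗ ρ₂(g)) with ρ₁, ρ₂ irreducible
pinned-geometric of dimensions a, d ≥ 2, n = a·d, ρ₂ of finite image): if weak geometric automorphy
holds at every rank m < n over every number field, then ρ is weakly automorphic — automorphic
induction along an arbitrary finite extension and GL_a × GL_d → GL_ad, cuspidality from
irreducibility. TAGS (decomp-langlands crit-1 CLEARED 2026-08-30T02:36:18Z (HOME/STATUS.md L80;
HOME/CRITIC-LEDGER.md row 19); census HOME/census/COSTUME-CENSUS-v2.md sha256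
92d1557a2c5727820a56011751c388b645a7fc2e57306ba099f059e21d7ae085): WEAKER (kernel
`pieces_of_weakGeometricAutomorphy` + exactness `weakGeometricAutomorphy_iff` / `_iff_exact`,
nodes/lens-2-g2-MonodromyDichotomy.lean; probes piece ⇏ Langlands ×4, piece ⇏ B_w ×3, drop-one ×4,
vacuity ×14 all as expected, nodes/lens-2-g2-MonodromyDichotomy.probes.lean) — S2 sees only ind -/
@[route_item "route-Langlands-MonodromyDichotomy", crux]
def StructuredTransport : Prop :=
  ∀ (K : Type) [Field K] [NumberField K] (n : ℕ) (hcpt : Literature.NumberTheory.Automorphic.isCompact_glFiniteIntegralLevel n K), 2 ≤ n → ∀ (ℓ : ℕ) [Fact ℓ.Prime] (ι : PadicAlgCl ℓ ≃+* ℂ) (ρ : Literature.NumberTheory.GaloisRepresentations.FramedGaloisRep K (PadicAlgCl ℓ) n), ρ.toGaloisRep.IsIrreducible → ((∀ᶠ v : IsDedekindDomain.HeightOneSpectrum (NumberField.RingOfIntegers K) in Filter.cofinite, ρ.IsUnramifiedAt v) ∧ ∀ (v : IsDedekindDomain.HeightOneSpectrum (NumberField.RingOfIntegers K)) (hv : ((ℓ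 : ℕ) : NumberField.RingOfIntegers K) ∈ v.asIdeal), (Literature.NumberTheory.PAdicHodge.fontainePstAdicCompletion v ℓ hv).IsDeRhamFramed (ρ.toLocal v)) → ((∃ (L : Type) (_ : Field L) (_ : NumberField L) (_ : Algebra K L) (m : ℕ) (σ : Literature.NumberTheory.GaloisRepresentations.FramedGaloisRep L (PadicAlgCl ℓ) m), 2 ≤ Module.finrank K L ∧ n = Module.finrank K L * m ∧ σ.toGaloisRep.IsIrreducible ∧ ((∀ᶠ v : IsDedekindDomain.HeightOneSpectrum (NumberField.RingOfIntegers L) in Filter.cofinite, σ.IsUnramifiedAt v) ∧ ∀ (v : IsDedekindDomain.HeightOneSpectrum (NumberField.RingOfIntegers L)) (hv : ((ℓ : ℕ) : NumberField.RingOfIntegers L) ∈ v.asIdeal), (Literature.NumberTheory.PAdicHodge.fontainePstAdicCompletion v ℓ hv).IsDeRhamFramed (σ.toLocal v)) ∧ ∀ g : Field.absoluteGaloisGroup K, Literature.NumberTheory.GaloisRepresentations.FramedRep.charpoly ρ g = Literature.NumberTheory.GaloisRepresentations.FramedRep.charpoly (σ.induce K (rfl : Module.finrank K L = Module.finrank K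 L)) g) ∨ (∃ (a d : ℕ) (ρ₁ : Literature.NumberTheory.GaloisRepresentations.FramedGaloisRep K (PadicAlgCl ℓ) a) (ρ₂ : Literature.NumberTheory.GaloisRepresentations.FramedGaloisRep K (PadicAlgCl ℓ) d), 2 ≤ a ∧ 2 ≤ d ∧ n = a * d ∧ ρ₁.toGaloisRep.IsIrreducible ∧ ((∀ᶠ v : IsDedekindDomain.HeightOneSpectrum (NumberField.RingOfIntegers K) in Filter.cofinite, ρ₁.IsUnramifiedAt v) ∧ ∀ (v : IsDedekindDomain.HeightOneSpectrum (NumberField.RingOfIntegers K)) (hv : ((ℓ : ℕ) : NumberField.RingOfIntegers K) ∈ v.asIdeal), (Literature.NumberTheory.PAdicHodge.fontainePstAdicCompletion v ℓ hv).IsDeRhamFramed (ρ₁.toLocal v)) ∧ ρ₂.toGaloisRep.IsIrreducible ∧ ((∀ᶠ v : IsDedekindDomain.HeightOneSpectrum (NumberField.RingOfIntegers K) in Filter.cofinite, ρ₂.IsUnramifiedAt v) ∧ ∀ (v : IsDedekindDomain.HeightOneSpectrum (NumberField.RingOfIntegers K)) (hv : ((ℓ : ℕ) : NumberField.RingOfIntegers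 K) ∈ v.asIdeal), (Literature.NumberTheory.PAdicHodge.fontainePstAdicCompletion v ℓ hv).IsDeRhamFramed (ρ₂.toLocal v)) ∧ (Set.range (fun g : Field.absoluteGaloisGroup K => (ρ₂ g : GL (Fin d) (PadicAlgCl ℓ)))).Finite ∧ ∀ g : Field.absoluteGaloisGroup K, Literature.NumberTheory.GaloisRepresentations.FramedRep.charpoly ρ g = (Matrix.kroneckerMap (· * ·) ((ρ₁ g : GL (Fin a) (PadicAlgCl ℓ)) : Matrix (Fin a) (Fin a) (PadicAlgCl ℓ)) ((ρ₂ g : GL (Fin d) (PadicAlgCl ℓ)) : Matrix (Fin d) (Fin d) (PadicAlgCl ℓ))).charpoly)) → (∀ m : ℕ, m < n → (∀ (E : Type) [Field E] [NumberField E] (hE : Literature.NumberTheory.Automorphic.isCompact_glFiniteIntegralLevel m E), 0 < m → ∀ (ℓ' : ℕ) [Fact ℓ'.Prime] (ι' : PadicAlgCl ℓ' ≃+* ℂ) (σ : Literature.NumberTheory.GaloisRepresentations.FramedGaloisRep E (PadicAlgCl ℓ') m), σ.toGaloisRep.IsIrreducible → ((∀ᶠ v : IsDedekindDomain.HeightOneSpectrum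 (NumberField.RingOfIntegers E) in Filter.cofinite, σ.IsUnramifiedAt v) ∧ ∀ (v : IsDedekindDomain.HeightOneSpectrum (NumberField.RingOfIntegers E)) (hv : ((ℓ' : ℕ) : NumberField.RingOfIntegers E) ∈ v.asIdeal), (Literature.NumberTheory.PAdicHodge.fontainePstAdicCompletion v ℓ' hv).IsDeRhamFramed (σ.toLocal v)) → ∃ π : Literature.NumberTheory.Automorphic.CuspidalAutomorphicRepData m E hE, π.1.IsLAlgebraic ∧ ∀ᶠ v : IsDedekindDomain.HeightOneSpectrum (NumberField.RingOfIntegers E) in Filter.cofinite, SatakeFrobCompatibleAt ι' π.1 σ v)) → ∃ π : Literature.NumberTheory.Automorphic.CuspidalAutomorphicRepData n K hcpt, π.1.IsLAlgebraic ∧ ∀ᶠ v : IsDedekindDomain.HeightOneSpectrum (NumberField.RingOfIntegers K) in Filter.cofinite, SatakeFrobCompatibleAt ι π.1 ρ v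

/-- item stmt-Langlands-17415 · crux · rank 5 · open · by planner
why it might fail: Galois representations for non-cohomological π (Maass forms of eigenvalue 1/4, mixed-signature fields) and irreducibility of r_π for n ≥ 3 are open.
sources: HarrisLanTaylorThorneRMS2016, Scholze2015, BuzzardGeeLMS2014
[crux] W⁺ — for every number field K, n ≥ 1, every L-algebraic cuspidal π of GL_n(𝔸_K) and every (ℓ,
ι) there is an IRREDUCIBLE ρ : Γ_K → GL_n(ℚ̄_ℓ) Satake–Frobenius compatible with (π, ι) at almost
all places (Buzzard–Gee Conj. 3.2.2 weak form + Ramakrishnan's cuspidal ⇒ irreducible; Clozel's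
Conj. 1.1.1 in arXiv:2607.11763). No de Rham clause, no Rec: ε-free and Rec-free. [difficulty:
open-problem] -/
@[route_item "route-Langlands-MonodromyDichotomy", crux]
def SatakeAvatarExistence : Prop :=
  ∀ (K : Type) [Field K] [NumberField K] (n : ℕ) (hcpt : Literature.NumberTheory.Automorphic.isCompact_glFiniteIntegralLevel n K), 0 < n → ∀ (π : Literature.NumberTheory.Automorphic.CuspidalAutomorphicRepData n K hcpt), π.1.IsLAlgebraic → ∀ (ℓ : ℕ) [Fact ℓ.Prime] (ι : PadicAlgCl ℓ ≃+* ℂ), ∃ ρ : Literature.NumberTheory.GaloisRepresentations.FramedGaloisRep K (PadicAlgCl ℓ) n, ρ.toGaloisRep.IsIrreducible ∧ ∀ᶠ v : IsDedekindDomain.HeightOneSpectrum (NumberField.RingOfIntegers K) in cofinite, SatakeFrobCompatibleAt ι π.1 ρ v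

/-- item stmt-Langlands-17534 · crux · rank 6 · open · by planner
why it might fail: ℓ = p local–global compatibility (de Rham + WD matching at v ∣ ℓ) for non-cohomological or non-polarizable π is open beyond the Shimura-variety cases.
sources: Caraiani2014, BLGGT2014, arXiv:2207.05235
[crux] P — the PRIME-SWITCH PRINCIPLE for the p-adic member of the automorphic compatible system
(Rec-parametric, Rec-free in content; rev 1, cone repair: stated over the summit's own predicates
only): for π L-algebraic cuspidal on GL_n/K, ρ an irreducible ℓ-adic avatar of (π, ι)
(Satake–Frobenius compatible a.e.) and a place v ∣ ℓ: (i) ρ|_v is de Rham for Fontaine's pinned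
datum; (ii) for EVERY reciprocity datum Rec, every prime ℓ' ∤ v, ι' and every irreducible ℓ'-adic
avatar ρ' of (π, ι'), local–global compatibility of (π, ρ') at v for Rec (read ℓ'-adically,
Grothendieck–Deligne) implies local–global compatibility of (π, ρ) at v for Rec (read through
D_pst). Mathematically (ii) is Fontaine's C_WD for the system {ρ_(π,ι)}: the
Frobenius-semisimplified Weil–Deligne representation at v of the p-adic member, computed by D_pst,
is the common one of the ℓ'-adic members (Saito arXiv:math/0612077 for Hilbert modular forms;
Caraiani 2012/2014 for Shimura varieties; AHTW 2026 Thm 1.2.1 up to semisimplification for regular π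
over CM). Kernel-certified consequence of `Langlands` (bc/SubsOfLanglands.lean); with L∤ at (π, ι',
ρ') it is Taylor's Conj. 7 at v ∣ ℓ — the glue's patching lemma. -/
@[route_item "route-Langlands-MonodromyDichotomy", crux]
def PadicMemberCompatibility : Prop :=
  ∀ (K : Type) [Field K] [NumberField K] (n : ℕ) (hcpt : Literature.NumberTheory.Automorphic.isCompact_glFiniteIntegralLevel n K), 0 < n → ∀ (π : Literature.NumberTheory.Automorphic.CuspidalAutomorphicRepData n K hcpt), π.1.IsLAlgebraic → ∀ (ℓ : ℕ) [Fact ℓ.Prime] (ι : PadicAlgCl ℓ ≃+* ℂ) (ρ : Literature.NumberTheory.GaloisRepresentations.FramedGaloisRep K (PadicAlgCl ℓ) n), ρ.toGaloisRep.IsIrreducible → (∀ᶠ v : IsDedekindDomain.HeightOneSpectrum (NumberField.RingOfIntegers K) in cofinite, SatakeFrobCompatibleAt ι π.1 ρ v) → ∀ (v : IsDedekindDomain.HeightOneSpectrum (NumberField.RingOfIntegers K)) (hv : ((ℓ : ℕ) : NumberField.RingOfIntegers K) ∈ v.asIdeal), (Literature.NumberTheory.PAdicHodge.fontainePstAdicCompletion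 v ℓ hv).IsDeRhamFramed (ρ.toLocal v) ∧ ∀ (Rec : ReciprocityData K) (ℓ' : ℕ) [Fact ℓ'.Prime] (ι' : PadicAlgCl ℓ' ≃+* ℂ) (ρ' : Literature.NumberTheory.GaloisRepresentations.FramedGaloisRep K (PadicAlgCl ℓ') n), ((ℓ' : ℕ) : NumberField.RingOfIntegers K) ∉ v.asIdeal → ρ'.toGaloisRep.IsIrreducible → (∀ᶠ w : IsDedekindDomain.HeightOneSpectrum (NumberField.RingOfIntegers K) in cofinite, SatakeFrobCompatibleAt ι' π.1 ρ' w) → LocalGlobalCompatibleAt Rec ι' π.1 ρ' v → LocalGlobalCompatibleAt Rec ι π.1 ρ v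

/-- item stmt-Langlands-18084 · crux · rank 7 · open · by planner
why it might fail: full local–global compatibility (monodromy operator N) at v ∤ ℓ is open in the non-polarizable / torsion settings (Varma gives it up to semisimplification).
sources: Varma2014, TaylorYoshida2007, Caraiani2012
[crux] L∤R — Taylor 2004 Conj. 7 at the places v ∤ ℓ, in the `∀ Rec` form (rev 4, lockstep re-type
after the summit re-type p141787 `∀ F, Nonempty (ReciprocityData F) ∧ ∀ 𝓡 …`): for every number
field K and EVERY reciprocity datum Rec (Henniart-normalised local Langlands data with THE canonical
Artin pins — the summit's `∀ 𝓡`), every n ≥ 1 and hcpt, every L-algebraic cuspidal π of GL_n(𝔸_K),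
every (ℓ, ι) and every IRREDUCIBLE ρ : Γ_K → GL_n(ℚ̄_ℓ) that is pinned-geometric (unramified a.e.,
de Rham above ℓ for Fontaine's pinned datum) and Satake–Frobenius compatible with (π, ι) a.e.:
`LocalGlobalCompatibleAt Rec ι π ρ v` at every finite v ∤ ℓ (Grothendieck–Deligne Weil–Deligne
representation, Frobenius-semisimplified, ↔ rec_v(π_v)). = item L∤ (stmt-Langlands-17417, ∃-Rec
form; verbatim the registered stub `stub_pairCompatibilityAway` of line `Sketch` of crux 14328) with
Rec moved from `∃ Rec,` to a universal binder after K and nothing else changed; the ∃-form is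
implied back by L∤R ∧ CanonicalReciprocityData (`compatibilityAwayFromL_existsForm`).
Kernel-certified consequence of the re-typed summit (`compatibilityAwayFromLR_of_langlands`, planner
bc/SubsOfLanglandsR.lean: direction (A -/
@[route_item "route-Langlands-MonodromyDichotomy", crux]
def CompatibilityAwayFromLR : Prop :=
  ∀ (K : Type) [Field K] [NumberField K] (Rec : ReciprocityData K) (n : ℕ) (hcpt : Literature.NumberTheory.Automorphic.isCompact_glFiniteIntegralLevel n K), 0 < n → ∀ (π : Literature.NumberTheory.Automorphic.CuspidalAutomorphicRepData n K hcpt), π.1.IsLAlgebraic → ∀ (ℓ : ℕ) [Fact ℓ.Prime] (ι : PadicAlgCl ℓ ≃+* ℂ) (ρ : Literature.NumberTheory.GaloisRepresentations.FramedGaloisRep K (PadicAlgCl ℓ) n), ρ.toGaloisRep.IsIrreducible → ((∀ᶠ v : IsDedekindDomain.HeightOneSpectrum (NumberField.RingOfIntegers K) in cofinite, ρ.IsUnramifiedAt v) ∧ ∀ (v : IsDedekindDomain.HeightOneSpectrum (NumberField.RingOfIntegers K)) (hv : ((ℓ : ℕ) : NumberField.RingOfIntegers K) ∈ v.asIdeal),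 (Literature.NumberTheory.PAdicHodge.fontainePstAdicCompletion v ℓ hv).IsDeRhamFramed (ρ.toLocal v)) → (∀ᶠ v : IsDedekindDomain.HeightOneSpectrum (NumberField.RingOfIntegers K) in cofinite, SatakeFrobCompatibleAt ι π.1 ρ v) → ∀ v : IsDedekindDomain.HeightOneSpectrum (NumberField.RingOfIntegers K), ((ℓ : ℕ) : NumberField.RingOfIntegers K) ∉ v.asIdeal → LocalGlobalCompatibleAt Rec ι π.1 ρ v

/-- item stmt-Langlands-17930 · support · rank 9 · open · by planner
why it might fail: print (LLC for GL_n); fails only if the tree's ReciprocityData structure demands a field beyond LLC + its standard properties.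
sources: HarrisTaylor2001, Henniart2000, Scholze2013LLC
[support] THE SUMMIT'S NON-VACUITY CONJUNCT, verbatim (statement revision p141787, 2026-08-17:
`Langlands := ∀ F, Nonempty (ReciprocityData F) ∧ ∀ 𝓡 n, 0 < n → ∀ hcpt, GLC n F 𝓡 hcpt`, with
`ReciprocityData` pinned to THE local Artin maps by `llc_isCanonical` / `llc_eps_isCanonical`),
filed by route-repair 5a1bd9af as the explicit INPUT of this route's `∃ RD`-shaped slices
(LiftB2Unram, LiftB2UnramSmallF, LiftB2UnramLargeF, LiftB2UnramSplitP): for every number field F and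
every finite place v, a local Langlands datum for GL_n(F_v) (Harris–Taylor 2001 Thm A; Henniart 2000
Thm 1.2) normalised against THE local Artin map `canonicalArtin (F_v)`, whose ε-system (Deligne 1973
Thm 4.1) is normalised against the canonical Artin map of every finite E/F_v. IN PRINT,
textbook-grade input (Harris–Taylor's Thm A is stated relative to Art_K of local class field
theory); in the TREE not yet derivable — `LocalLanglandsDatum.nonempty` (cite-only) yields a datum
with SOME lawful Artin normalisation, and canonicity needs `IsLocalArtinMap.unique` + the
finite-level reciprocity law for that datum's Artin maps, or canonical variants of
`localLanglands_gl` / `nonempty_localEpsilonSystem` (needs-fact for -/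
@[route_item "route-Langlands-MonodromyDichotomy", crux]
def CanonicalReciprocityData : Prop :=
  ∀ (F : Type) [Field F] [NumberField F], Nonempty (Summit.Langlands.ReciprocityData F)

/-- item stmt-Langlands-24805 · support · rank 9 · open · by planner
why it might fail: print; fails only if the pinned de Rham predicate at ℓ did not imply local algebraicity of the Hecke character (it does: de Rham characters are Hodge–Tate, Serre III.A.5).
sources: Serre1968AbelianEllAdic, Weil1956Hecke
[support] Grade 1 of the ladder: every (irreducible) pinned-geometric ℓ-adic character of Γ_K is
weakly automorphic (an L-algebraic Hecke character matching a.e.). Verbatim the registered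
stub_rankOne (Cruxes/SectorComplement/Lines/birth_WeakGeometricAutomorphy.lean); print: class field
theory + Weil 1956 + Serre 1968 III.2.3 + abelian Fontaine–Mazur. TAGS: WEAKER · PRINT ·
ATTACKABLE[closed-mod-print; = the registered `stub_rankOne` verbatim — one proof closes both].
[difficulty: provable-now] -/
@[route_item "route-Langlands-MonodromyDichotomy", crux]
def RankOneAutomorphy : Prop :=
  ∀ (K : Type) [Field K] [NumberField K] (hcpt : Literature.NumberTheory.Automorphic.isCompact_glFiniteIntegralLevel 1 K) (ℓ : ℕ) [Fact ℓ.Prime] (ι : PadicAlgCl ℓ ≃+* ℂ) (ρ : Literature.NumberTheory.GaloisRepresentations.FramedGaloisRep K (PadicAlgCl ℓ) 1), ρ.toGaloisRep.IsIrreducible → ((∀ᶠ v : IsDedekindDomain.HeightOneSpectrum (NumberField.RingOfIntegers K) in cofinite, ρ.IsUnramifiedAt v) ∧ ∀ (v : IsDedekindDomain.HeightOneSpectrum (NumberField.RingOfIntegers K)) (hv : ((ℓ : ℕ) : NumberField.RingOfIntegers K) ∈ v.asIdeal), (Literature.NumberTheory.PAdicHodge.fontainePstAdicCompletion v ℓ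 hv).IsDeRhamFramed (ρ.toLocal v)) → ∃ π : Literature.NumberTheory.Automorphic.CuspidalAutomorphicRepData 1 K hcpt, π.1.IsLAlgebraic ∧ ∀ᶠ v : IsDedekindDomain.HeightOneSpectrum (NumberField.RingOfIntegers K) in cofinite, SatakeFrobCompatibleAt ι π.1 ρ v

/-- item stmt-Langlands-25620 · support · rank 9 · closed · proved by Summit.Langlands.Langlands.Theorems.cliffordTateStructure_proof (prover) · by planner
why it might fail: only through typing: if the pinned IsDeRhamFramed / a.e.-unramified predicates lacked heredity under finite restriction, sub-objects and ⊗ by a finite-image rep (those Literature facts land first); FramedGaloisRep.induce models Ind up to conjugacy (charpoly_induce_eq_charpoly_comp_indMatrix).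
sources: arXiv:1207.6724, Katz1990ESDE, SerreLinearRepresentations1977, Clifford1937, arXiv:1307.1640
[support] (T, PRINT: Patrikis arXiv:1207.6724 Prop. 4.1.1 + Tate lift; Katz ESDE Prop. 2.7.2;
Clifford) an irreducible pinned-geometric ℓ-adic ρ of rank n ≥ 2 that is neither Lie-irreducible nor
of finite projective image is induced from an irreducible pinned-geometric representation of a
proper finite extension, or is an Artin–Kronecker product with both factors irreducible
pinned-geometric of dimension ≥ 2 and the second of finite image — in characteristic-polynomial form
(geometricity of the factors: σ ⊂ ρ|Γ_L; ρ₁ ⊂ ρ ⊗ ρ₂^∨). TAGS (decomp-langlands crit-1 CLEARED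
2026-08-30T02:36:18Z (HOME/STATUS.md L80; HOME/CRITIC-LEDGER.md row 19); census
HOME/census/COSTUME-CENSUS-v2.md sha256
92d1557a2c5727820a56011751c388b645a7fc2e57306ba099f059e21d7ae085): PRINT support (Clifford theory +
ℓ-adic Tate lift: Patrikis arXiv:1207.6724 Prop. 4.1.1; Katz ESDE Prop. 2.7.2) — the critic verified
the trichotomy is TRUE in print as typed (Γ⁰ := ρ⁻¹(G⁰): non-isotypic ⇒ induced from the stabiliser
with an irreducible pinned-geometric summand; isotypic ⇒ τ ⊗ ω with τ Lie-irreducible after the Tate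
lift and ω of finite projective image; d = 1 contradicts ¬G, a = 1 contradicts ¬S1; τ de Rham as a
sub o -/
@[route_item "route-Langlands-MonodromyDichotomy", crux]
def CliffordTateStructure : Prop :=
  ∀ (K : Type) [Field K] [NumberField K] (n : ℕ), 2 ≤ n → ∀ (ℓ : ℕ) [Fact ℓ.Prime] (ρ : Literature.NumberTheory.GaloisRepresentations.FramedGaloisRep K (PadicAlgCl ℓ) n), ρ.toGaloisRep.IsIrreducible → ((∀ᶠ v : IsDedekindDomain.HeightOneSpectrum (NumberField.RingOfIntegers K) in Filter.cofinite, ρ.IsUnramifiedAt v) ∧ ∀ (v : IsDedekindDomain.HeightOneSpectrum (NumberField.RingOfIntegers K)) (hv : ((ℓ : ℕ) : NumberField.RingOfIntegers K) ∈ v.asIdeal), (Literature.NumberTheory.PAdicHodge.fontainePstAdicCompletion v ℓ hv).IsDeRhamFramed (ρ.toLocal v)) → ¬ (∀ (L : Type) [Field L] [NumberField L] [Algebra K L], (ρ.restrictField L).toGaloisRep.IsIrreducible) → ¬ (∃ (L : Type) (_ : Field L) (_ : NumberField L) (_ : Algebra K L), ∀ σ : Field.absoluteGaloisGroup L, ∃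 c : PadicAlgCl ℓ, ((ρ.restrictField L σ : GL (Fin n) (PadicAlgCl ℓ)) : Matrix (Fin n) (Fin n) (PadicAlgCl ℓ)) = c • (1 : Matrix (Fin n) (Fin n) (PadicAlgCl ℓ))) → (∃ (L : Type) (_ : Field L) (_ : NumberField L) (_ : Algebra K L) (m : ℕ) (σ : Literature.NumberTheory.GaloisRepresentations.FramedGaloisRep L (PadicAlgCl ℓ) m), 2 ≤ Module.finrank K L ∧ n = Module.finrank K L * m ∧ σ.toGaloisRep.IsIrreducible ∧ ((∀ᶠ v : IsDedekindDomain.HeightOneSpectrum (NumberField.RingOfIntegers L) in Filter.cofinite, σ.IsUnramifiedAt v) ∧ ∀ (v : IsDedekindDomain.HeightOneSpectrum (NumberField.RingOfIntegers L)) (hv : ((ℓ : ℕ) : NumberField.RingOfIntegers L) ∈ v.asIdeal), (Literature.NumberTheory.PAdicHodge.fontainePstAdicCompletion v ℓ hv).IsDeRhamFramed (σ.toLocal v)) ∧ ∀ g : Field.absoluteGaloisGroup K, Literature.NumberTheory.GaloisRepresentations.FramedRep.charpoly ρ g = Literature.NumberTheory.GaloisRepresentations.FramedRep.charpoly (σ.induce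 K (rfl : Module.finrank K L = Module.finrank K L)) g) ∨ (∃ (a d : ℕ) (ρ₁ : Literature.NumberTheory.GaloisRepresentations.FramedGaloisRep K (PadicAlgCl ℓ) a) (ρ₂ : Literature.NumberTheory.GaloisRepresentations.FramedGaloisRep K (PadicAlgCl ℓ) d), 2 ≤ a ∧ 2 ≤ d ∧ n = a * d ∧ ρ₁.toGaloisRep.IsIrreducible ∧ ((∀ᶠ v : IsDedekindDomain.HeightOneSpectrum (NumberField.RingOfIntegers K) in Filter.cofinite, ρ₁.IsUnramifiedAt v) ∧ ∀ (v : IsDedekindDomain.HeightOneSpectrum (NumberField.RingOfIntegers K)) (hv : ((ℓ : ℕ) : NumberField.RingOfIntegers K) ∈ v.asIdeal), (Literature.NumberTheory.PAdicHodge.fontainePstAdicCompletion v ℓ hv).IsDeRhamFramed (ρ₁.toLocal v)) ∧ ρ₂.toGaloisRep.IsIrreducible ∧ ((∀ᶠ v : IsDedekindDomain.HeightOneSpectrum (NumberField.RingOfIntegers K) in Filter.cofinite, ρ₂.IsUnramifiedAt v) ∧ ∀ (v : IsDedekindDomain.HeightOneSpectrum (NumberField.RingOfIntegers K)) (hv :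 ((ℓ : ℕ) : NumberField.RingOfIntegers K) ∈ v.asIdeal), (Literature.NumberTheory.PAdicHodge.fontainePstAdicCompletion v ℓ hv).IsDeRhamFramed (ρ₂.toLocal v)) ∧ (Set.range (fun g : Field.absoluteGaloisGroup K => (ρ₂ g : GL (Fin d) (PadicAlgCl ℓ)))).Finite ∧ ∀ g : Field.absoluteGaloisGroup K, Literature.NumberTheory.GaloisRepresentations.FramedRep.charpoly ρ g = (Matrix.kroneckerMap (· * ·) ((ρ₁ g : GL (Fin a) (PadicAlgCl ℓ)) : Matrix (Fin a) (Fin a) (PadicAlgCl ℓ)) ((ρ₂ g : GL (Fin d) (PadicAlgCl ℓ)) : Matrix (Fin d) (Fin d) (PadicAlgCl ℓ))).charpoly)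

-- `CliffordTateStructure` holds: proved by `Summit.Langlands.Langlands.Theorems.cliffordTateStructure_proof` (its module imports this route file, so no `_holds` link can be stated here).

/-- item stmt-Langlands-25621 · assembly · rank 1 · closed · proved by Summit.Langlands.Langlands.Theorems.monodromyDichotomy_assembly_proof (prover) · by planner
sources: arXiv:1207.6724, ArthurClozel1989, BuzzardGeeLMS2014
[assembly] RankOneAutomorphy → LieIrreducibleAutomorphy → ArtinTypeAutomorphy →
CliffordTateStructure → StructuredTransport → SatakeAvatarExistence → PadicMemberCompatibility →
CompatibilityAwayFromLR → CanonicalReciprocityData → Langlands. -/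
@[route_item "route-Langlands-MonodromyDichotomy"]
def Assembly : Prop :=
  RankOneAutomorphy → LieIrreducibleAutomorphy → ArtinTypeAutomorphy → CliffordTateStructure → StructuredTransport → SatakeAvatarExistence → PadicMemberCompatibility → CompatibilityAwayFromLR → CanonicalReciprocityData → _root_.Langlands

-- `Assembly` holds: proved by `Summit.Langlands.Langlands.Theorems.monodromyDichotomy_assembly_proof` (its module imports this route file, so no `_holds` link can be stated here).

/-! D-0027 §2.1 — DECIDING THEOREM (planner-authored via `route open/edit --closes-file`; by planner-decomp-langlands-writer-1-g2-0 2026-08-30T02:44:36Z):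
its hypotheses are this route's items and its conclusion the sub-problem Statement (glue_lint), and it elaborates with this file. -/

/- (spliced by the gate into the rendered route file via `--closes-file`; not a standalone module — certify with
   `ledger route check --native route.json --closes-file glue.lean`)
   D-0027 §2.1 deciding theorem for route MonodromyDichotomy (decomp-langlands lens-2 gen 2).
   Self-contained: works over the INLINED one-liner items (no helper lemmas). Level 2 = B_w at every rank by strong induction
   on n with the connected-monodromy case split (n = 1: RankOneAutomorphy; n ≥ 2: Lie-irreducible → LieIrreducibleAutomorphy |
   finite projective image → ArtinTypeAutomorphy | else CliffordTateStructure gives the induced / Artin–Kronecker shape and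
   StructuredTransport closes it from the induction hypothesis); level 1 = N0's assembly (prime switch ℓ' ∈ {2,3} + avatar
   transport, U := the landed theorem `Theorems.EisensteinDegreeShiftSectorComplement.stub_avatarConjugacy`), verbatim the frame of record. -/
@[closes "route-Langlands-MonodromyDichotomy"] theorem closes (h1 : RankOneAutomorphy) (hG : LieIrreducibleAutomorphy) (hS : ArtinTypeAutomorphy)
    (hT : CliffordTateStructure) (hX : StructuredTransport) (hW : SatakeAvatarExistence)
    (hP : PadicMemberCompatibility) (hA : CompatibilityAwayFromLR) (hR : CanonicalReciprocityData) : _root_.Langlands := by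
  -- `Assembly` (item) is literally the curried form of this theorem: prove it, then apply it (writer convention).
  suffices hAsm : Assembly from hAsm h1 hG hS hT hX hW hP hA hR
  clear h1 hG hS hT hX hW hP hA hR
  intro h1 hG hS hT hX hW hP hA hR
  have hU := @_root_.Summit.Langlands.Langlands.Theorems.EisensteinDegreeShiftSectorComplement.stub_avatarConjugacy
  -- LEVEL 2: weak geometric automorphy at every rank (strong induction on the rank, monodromy case split)
  have hAll : ∀ n : ℕ, (∀ (E : Type) [Field E] [NumberField E] (hE : Literature.NumberTheory.Automorphic.isCompact_glFiniteIntegralLevel n E), 0 < n → ∀ (ℓ' : ℕ) [Fact ℓ'.Prime] (ι' : PadicAlgCl ℓ' ≃+* ℂ) (σ : Literature.NumberTheory.GaloisRepresentations.FramedGaloisRep E (PadicAlgCl ℓ') n), σ.toGaloisRep.IsIrreducible → ((∀ᶠ v : IsDedekindDomain.HeightOneSpectrum (NumberField.RingOfIntegers E) in Filter.cofinite, σ.IsUnramifiedAt v) ∧ ∀ (v : IsDedekindDomain.HeightOneSpectrum (NumberField.RingOfIntegers E)) (hv : ((ℓ' : ℕ) : NumberField.RingOfIntegers E) ∈ v.asIdeal),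 (Literature.NumberTheory.PAdicHodge.fontainePstAdicCompletion v ℓ' hv).IsDeRhamFramed (σ.toLocal v)) → ∃ π : Literature.NumberTheory.Automorphic.CuspidalAutomorphicRepData n E hE, π.1.IsLAlgebraic ∧ ∀ᶠ v : IsDedekindDomain.HeightOneSpectrum (NumberField.RingOfIntegers E) in Filter.cofinite, SatakeFrobCompatibleAt ι' π.1 σ v) := by
    intro n
    induction n using Nat.strong_induction_on with
    | _ n ih =>
      intro K _ _ hcpt hn ℓ _ ι ρ hirr hgeo
      rcases Nat.lt_or_ge n 2 with hlt | hge
      · obtain rfl : n = 1 := by omega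
        exact h1 K hcpt ℓ ι ρ hirr hgeo
      · by_cases hL : (∀ (L : Type) [Field L] [NumberField L] [Algebra K L], (ρ.restrictField L).toGaloisRep.IsIrreducible)
        · exact hG K n hcpt hge ℓ ι ρ hirr hgeo hL
        · by_cases hF : (∃ (L : Type) (_ : Field L) (_ : NumberField L) (_ : Algebra K L), ∀ σ : Field.absoluteGaloisGroup L, ∃ c : PadicAlgCl ℓ, ((ρ.restrictField L σ : GL (Fin n) (PadicAlgCl ℓ)) : Matrix (Fin n) (Fin n) (PadicAlgCl ℓ)) = c • (1 : Matrix (Fin n) (Fin n) (PadicAlgCl ℓ)))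
          · exact hS K n hcpt hge ℓ ι ρ hirr hgeo hF
          · exact hX K n hcpt hge ℓ ι ρ hirr hgeo (hT K n hge ℓ ρ hirr hgeo hL hF) (fun m hm => ih m hm)
  have hB : ∀ (K : Type) [Field K] [NumberField K] (n : ℕ) (hcpt : Literature.NumberTheory.Automorphic.isCompact_glFiniteIntegralLevel n K), 0 < n → ∀ (ℓ : ℕ) [Fact ℓ.Prime] (ι : PadicAlgCl ℓ ≃+* ℂ) (ρ : Literature.NumberTheory.GaloisRepresentations.FramedGaloisRep K (PadicAlgCl ℓ) n), ρ.toGaloisRep.IsIrreducible → ((∀ᶠ v : IsDedekindDomain.HeightOneSpectrum (NumberField.RingOfIntegers K) in Filter.cofinite, ρ.IsUnramifiedAt v) ∧ ∀ (v : IsDedekindDomain.HeightOneSpectrum (NumberField.RingOfIntegers K)) (hv : ((ℓ : ℕ) : NumberField.RingOfIntegers K) ∈ v.asIdeal), (Literature.NumberTheory.PAdicHodge.fontainePstAdicCompletion v ℓ hv).IsDeRhamFramed (ρ.toLocal v)) → ∃ π : Literature.NumberTheory.Automorphic.CuspidalAutomorphicRepData n K hcpt, π.1.IsLAlgebraic ∧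 ∀ᶠ v : IsDedekindDomain.HeightOneSpectrum (NumberField.RingOfIntegers K) in Filter.cofinite, SatakeFrobCompatibleAt ι π.1 ρ v :=
    fun K _ _ n hcpt hn ℓ _ ι ρ hirr hgeo => hAll n K hcpt hn ℓ ι ρ hirr hgeo
  -- LEVEL 1: the frame of record (N0 = PrimeSwitchSplit rev 4), verbatim
  intro F _ _
  refine ⟨hR F, fun Rec n hn hcpt => ?_⟩
  have hRec := hA F Rec
  have hprime : ∀ v : IsDedekindDomain.HeightOneSpectrum (NumberField.RingOfIntegers F),
      ∃ (ℓ' : ℕ) (_ : Fact ℓ'.Prime), ((ℓ' : ℕ) : NumberField.RingOfIntegers F) ∉ v.asIdeal := by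
    intro v
    by_cases h2 : ((2 : ℕ) : NumberField.RingOfIntegers F) ∈ v.asIdeal
    · refine ⟨3, ⟨Nat.prime_three⟩, fun h3 => v.isPrime.ne_top ((Ideal.eq_top_iff_one _).2 ?_)⟩
      have h := v.asIdeal.sub_mem h3 h2
      have h1 : ((3 : ℕ) : NumberField.RingOfIntegers F) - ((2 : ℕ) : NumberField.RingOfIntegers F) = 1 := by
        push_cast; norm_num
      rwa [h1] at h
    · exact ⟨2, ⟨Nat.prime_two⟩, h2⟩
  have hLGC : ∀ (π : Literature.NumberTheory.Automorphic.CuspidalAutomorphicRepData n F hcpt), π.1.IsLAlgebraic →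
      ∀ (ℓ : ℕ) [Fact ℓ.Prime] (ι : PadicAlgCl ℓ ≃+* ℂ)
        (ρ : Literature.NumberTheory.GaloisRepresentations.FramedGaloisRep F (PadicAlgCl ℓ) n),
        ρ.toGaloisRep.IsIrreducible →
        (∀ᶠ v : IsDedekindDomain.HeightOneSpectrum (NumberField.RingOfIntegers F) in Filter.cofinite,
          SatakeFrobCompatibleAt ι π.1 ρ v) →
        IsGeometricFramed Rec ρ ∧
          ∀ v : IsDedekindDomain.HeightOneSpectrum (NumberField.RingOfIntegers F),
            LocalGlobalCompatibleAt Rec ι π.1 ρ v := by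
    intro π hL ℓ _ ι ρ hirr hρ
    have hgeo : (∀ᶠ v : IsDedekindDomain.HeightOneSpectrum (NumberField.RingOfIntegers F) in Filter.cofinite,
        ρ.IsUnramifiedAt v) ∧
        ∀ (v : IsDedekindDomain.HeightOneSpectrum (NumberField.RingOfIntegers F))
          (hv : ((ℓ : ℕ) : NumberField.RingOfIntegers F) ∈ v.asIdeal),
          (Literature.NumberTheory.PAdicHodge.fontainePstAdicCompletion v ℓ hv).IsDeRhamFramed
            (ρ.toLocal v) :=
      ⟨hρ.mono fun v ⟨_, _, hur, _⟩ => hur, fun v hv => (hP F n hcpt hn π hL ℓ ι ρ hirr hρ v hv).1⟩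
    refine ⟨hgeo, fun v => ?_⟩
    by_cases hv : ((ℓ : ℕ) : NumberField.RingOfIntegers F) ∈ v.asIdeal
    · obtain ⟨ℓ', _, hℓ'⟩ := hprime v
      obtain ⟨ι'⟩ := PadicAlgCl.nonempty_ringEquiv_complex ℓ'
      obtain ⟨ρ', hirr', hρ'⟩ := hW F n hcpt hn π hL ℓ' ι'
      have hgeo' : (∀ᶠ w : IsDedekindDomain.HeightOneSpectrum (NumberField.RingOfIntegers F) in Filter.cofinite,
          ρ'.IsUnramifiedAt w) ∧
          ∀ (w : IsDedekindDomain.HeightOneSpectrum (NumberField.RingOfIntegers F))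
            (hw : ((ℓ' : ℕ) : NumberField.RingOfIntegers F) ∈ w.asIdeal),
            (Literature.NumberTheory.PAdicHodge.fontainePstAdicCompletion w ℓ' hw).IsDeRhamFramed
              (ρ'.toLocal w) :=
        ⟨hρ'.mono fun w ⟨_, _, hur, _⟩ => hur,
          fun w hw => (hP F n hcpt hn π hL ℓ' ι' ρ' hirr' hρ' w hw).1⟩
      exact (hP F n hcpt hn π hL ℓ ι ρ hirr hρ v hv).2 Rec ℓ' ι' ρ' hℓ' hirr' hρ'
        (hRec n hcpt hn π hL ℓ' ι' ρ' hirr' hgeo' hρ' v hℓ')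
    · exact hRec n hcpt hn π hL ℓ ι ρ hirr hgeo hρ v hv
  refine ⟨?_, ?_⟩
  · intro π hL ℓ _ ι
    obtain ⟨ρ, hirr, hρ⟩ := hW F n hcpt hn π hL ℓ ι
    obtain ⟨hgeo, hloc⟩ := hLGC π hL ℓ ι ρ hirr hρ
    exact ⟨ρ, hirr, hgeo, ⟨hρ, hloc⟩, fun ρ' h' => hU F n hcpt π ℓ ι ρ ρ' hirr hρ h'.1⟩
  · intro ℓ _ ι ρ hirr hgeo
    obtain ⟨π, hL, hρ⟩ := hB F n hcpt hn ℓ ι ρ hirr hgeo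
    exact ⟨π, hL, hρ, (hLGC π hL ℓ ι ρ hirr hρ).2⟩

end Summit.Langlands.Langlands.Theses.MonodromyDichotomy
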